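import Mathlib.Analysis.Convex.PathConnected
import Literature.Probability.Percolation.RhombicTilingTracks
import Literature.Probability.LatticeModels.IsoradialSquareGrid
import HarnessLib

/-!
# Planarity of rhombic tilings: the geometry of a square grid (sides of tracks, order, gaps, arcs)

Topic `Literature/Probability/Percolation`. Grimmett–Manolescu (PTRF 159 (2014) =
arXiv:1204.0505, §4.2 and §4.5) use the track system of a rhombic tiling *as drawn in the
plane*: a track separates the plane into two sides; the tracks of each class of a square grid
are "indexed in order"; "every `x ∈ ℝ²` lies either in some track of `T_k` or in the region of
`ℝ²` between two consecutive elements of `T_k`"; a face is *between* two tracks; the tracks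
`t_i`, `s_j` cross exactly once and the arc of `t_i` between `s_j` and `s_{j+1}` has fewer than
`I` rhombi (SGP (c)). For the tree's abstract square grids `RhombicEmbedding.IsSquareGridGM s t I`
(sequences of rhombi) and the strips/ribbons of `RhombicTilingCornerConsistency` /
`RhombicTilingTracks`, under `PlanarTilingHyps emb ε`, this file proves that planar picture, in
three parts:

1. **Sides of a strip** (`StripData.levelPt`, `StripData.isPathConnected_setOf_a_lt/lt_a`,
   `Ribbon.side_of_disjoint`, `Ribbon.nest_of_subset_upper/lower`): level curves of the
   longitudinal coordinate, path-connectedness of the two open sides, a disjoint ribbon lies on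
   one side, nesting of sides.
2. **Order** (`Ribbon.cross_opposite`, `Ribbon.halves_of_cross`, `GridOrder.b`,
   `GridOrder.t_subset_upper/lower`, `GridOrder.lt_one_subset_neg`,
   `GridOrder.exists_strip_or_gap`): a ribbon crossing another passes from one side to the
   other; with the transversal `s 0` the family `t` is ordered — in the oriented coordinate `b_i`
   (`= a_i` or `1 - a_i`) all `t j`, `j > i`, lie in `{1 ≤ b_i}` and all `t j`, `j < i`, in
   `{b_i ≤ 0}`; the open lower sides nest; every point lies in a strip or in the open *gap*
   between two consecutive tracks.
3. **Gaps and arcs** (`GridOrder.gap`, `GridOrder.exists_interior_subset_gap`,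
   `GridOrder.across_of_gap`, `GridOrder.arc`): a face on no `t m` has its interior in one gap;
   across a side of a gap face lies a gap face or a face of one of the two bounding tracks; the
   crossings of `t m` with `s j`, `s (j+1)` are unique indices `κ ≠ κ'` at most `I` apart and the
   faces of `t m` outside `[min κ κ', max κ κ']` lie below `s j` or above `s (j+1)`.

## References

* G. R. Grimmett, I. Manolescu, *Bond percolation on isoradial graphs*, PTRF 159 (2014),
  arXiv:1204.0505, §4.2 (square grids, SGP (a)–(c)), §4.5 (domains between tracks, cells).
* N. G. de Bruijn, *Algebraic theory of Penrose's non-periodic tilings*, Indag. Math. 43 (1981), §4.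
-/

/-!
## Part XII: the two sides of a track, and how disjoint tracks nest

Topic `Literature/Probability/Percolation`. Grimmett–Manolescu (PTRF 159 (2014) =
arXiv:1204.0505, §4.2 and §4.5) use the tracks of a rhombic tiling "viewed as arcs of `ℝ²`":
a track separates the plane into two sides, a point is "strictly between" two non-intersecting
tracks `t, t'`, the tracks of a square grid are "indexed in order", "every `x ∈ ℝ²` lies either in
some track of `T_k` or in the region between two consecutive elements of `T_k`". In the tree a
track is a ribbon = a strip (`StripData`, parts VI–VII): `{0 ≤ a ≤ 1}` for the continuous
longitudinal coordinate `a`, with the two closed sides `{a ≤ 0}`, `{1 ≤ a}`. This file supplies the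
topology of these sides:

* `StripData.a_add_real_mul_w` — `a (Y + c w) = a Y + c` (moving along the shared direction);
  `StripData.levelPt`, `continuous_levelPt`, `t_levelPt`, `a_levelPt` — the level curves
  `{a = c}` are bi-infinite continuous curves parametrised by the transversal height;
* `StripData.isPathConnected_setOf_a_lt`, `…_setOf_lt_a` — **each (open) side of a strip is
  path-connected**;
* `Ribbon.side_of_disjoint` — **a ribbon having no rhombus in common with another lies entirely
  on one side of it**;
* `Ribbon.nest_of_subset_upper`, `Ribbon.nest_of_subset_lower` — **nesting**: if the ribbon `R'`
  lies in the upper side `{1 ≤ a_R}` of `R`, then the open lower side `{a_R < 1}` of `R` lies in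
  one open side of `R'` (and symmetrically) — the input for ordering the tracks of a square grid
  (§4.5, the domains between consecutive tracks, in the sequel).

## References

* G. R. Grimmett, I. Manolescu, *Bond percolation on isoradial graphs*, PTRF 159 (2014),
  arXiv:1204.0505, §4.2, §4.5 (tracks as arcs; points between tracks).
* N. G. de Bruijn, *Algebraic theory of Penrose's non-periodic tilings*, Indag. Math. 43 (1981), §4.
-/

noncomputable section

open Complex ComplexConjugate Metric Set Filter Topology

namespace Literature.Probability.Percolation

/-! ### Generic strips: moving along `w`, level curves, connected sides -/

namespace StripData

variable (D : StripData)

/-- The longitudinal coordinate of the `n`-th frame is affine of slope `1` along `w`. [folklore] -/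
theorem alpha_add_real_mul_w (n : ℤ) (Y : ℂ) (c : ℝ) : D.alpha n (Y + (c : ℂ) * D.w) = D.alpha n Y + c := by
  have hD := (D.isQuad n).det_ne_zero
  unfold alpha coordP
  have : D.L n + D.w - D.L n = D.w := by ring
  rw [sideFn_add_smul]
  have h2 : (D.w * conj (D.L (n + 1) - D.L n)).im = sideFn (D.L n) (D.L (n + 1)) (D.L n + D.w) := by
    simp only [sideFn, add_sub_cancel_left]
  rw [h2, add_div, mul_div_assoc, div_self hD, mul_one]

/-- **`a (Y + c w) = a Y + c`.** [folklore] -/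
theorem a_add_real_mul_w (Y : ℂ) (c : ℝ) : D.a (Y + (c : ℂ) * D.w) = D.a Y + c := by
  unfold a
  rw [D.t_add_real_mul_w, D.alpha_add_real_mul_w]

/-- The point of the level curve `{a = c}` at transversal height `τ`. [folklore] -/
def levelPt (c τ : ℝ) : ℂ :=
  D.L (D.idx τ) + (c : ℂ) * D.w +
    (((τ - D.tn (D.idx τ)) / (D.tn (D.idx τ + 1) - D.tn (D.idx τ)) : ℝ) : ℂ) *
      (D.L (D.idx τ + 1) - D.L (D.idx τ))

/-- The affine pieces of the level curve. [folklore] -/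
def levelPiece (c : ℝ) (n : ℤ) (τ : ℝ) : ℂ :=
  D.L n + (c : ℂ) * D.w + (((τ - D.tn n) / (D.tn (n + 1) - D.tn n) : ℝ) : ℂ) * (D.L (n + 1) - D.L n)

/-- The affine pieces of a level curve are continuous. [folklore] -/
theorem continuous_levelPiece (c : ℝ) (n : ℤ) : Continuous (D.levelPiece c n) := by
  unfold levelPiece; fun_prop

/-- On the `n`-th closed slab the level curve is its `n`-th affine piece (the pieces glue at the
slab boundaries). [folklore] -/
theorem levelPt_eq_levelPiece {c τ : ℝ} {n : ℤ} (h1 : D.tn n ≤ τ) (h2 : τ ≤ D.tn (n + 1)) :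
    D.levelPt c τ = D.levelPiece c n τ := by
  rcases h2.lt_or_eq with h2 | h2
  · rw [levelPt, D.idx_eq_iff.2 ⟨h1, h2⟩]; rfl
  · have hidx : D.idx τ = n + 1 := by
      rw [D.idx_eq_iff]; refine ⟨h2.ge, ?_⟩; rw [h2]; exact D.tn_strictMono (lt_add_one _)
    rw [levelPt, hidx, levelPiece, h2]
    have hΔ : D.tn (n + 1) - D.tn n ≠ 0 := (sub_pos.2 (D.tn_strictMono (lt_add_one n))).ne'
    rw [sub_self, zero_div, div_self hΔ]
    push_cast; ring

/-- **The level curves are continuous.** [folklore] -/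
theorem continuous_levelPt (c : ℝ) : Continuous (D.levelPt c) := by
  have hlf : LocallyFinite fun n : ℤ => Icc (D.tn n) (D.tn (n + 1)) := by
    intro τ
    obtain ⟨N₁, hN₁⟩ := D.exists_lt_tn (τ + 1)
    obtain ⟨N₀, hN₀⟩ := D.exists_tn_le (τ - 1)
    refine ⟨Ioo (τ - 1) (τ + 1), Ioo_mem_nhds (by linarith) (by linarith), ?_⟩
    refine (Set.finite_Ioo (N₀ - 1) N₁).subset ?_
    rintro n ⟨σ, ⟨h1, h2⟩, h3, h4⟩
    constructor
    · have : D.tn N₀ < D.tn (n + 1) := by linarith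
      have := D.tn_strictMono.lt_iff_lt.1 this; omega
    · have : D.tn n < D.tn N₁ := by linarith
      exact D.tn_strictMono.lt_iff_lt.1 this
  have hcov : ⋃ n : ℤ, Icc (D.tn n) (D.tn (n + 1)) = univ :=
    eq_univ_of_forall fun τ => mem_iUnion.2 ⟨D.idx τ, D.tn_idx_le τ, (D.lt_tn_idx_succ τ).le⟩
  refine hlf.continuous hcov (fun n => isClosed_Icc) fun n => ?_
  exact (D.continuous_levelPiece c n).continuousOn.congr fun τ hτ => D.levelPt_eq_levelPiece hτ.1 hτ.2

/-- The level curve has the prescribed transversal height. [folklore] -/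
theorem t_levelPt (c τ : ℝ) : D.t (D.levelPt c τ) = τ := by
  set n := D.idx τ with hn
  have hΔ : D.tn (n + 1) - D.tn n ≠ 0 := (sub_pos.2 (D.tn_strictMono (lt_add_one n))).ne'
  have key : D.t (D.levelPt c τ) = D.tn n + (τ - D.tn n) / (D.tn (n + 1) - D.tn n) * (D.tn (n + 1) - D.tn n) := by
    rw [levelPt, ← hn]
    rw [show D.L n + (c : ℂ) * D.w + (((τ - D.tn n) / (D.tn (n + 1) - D.tn n) : ℝ) : ℂ) *
        (D.L (n + 1) - D.L n) = (D.L n + (((τ - D.tn n) / (D.tn (n + 1) - D.tn n) : ℝ) : ℂ) *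
        (D.L (n + 1) - D.L n)) + (c : ℂ) * D.w by ring]
    rw [D.t_add_real_mul_w, StripData.t, sideFn_add_smul]
    have : ((D.L (n + 1) - D.L n) * conj (D.L 0 + D.w - D.L 0)).im = D.tn (n + 1) - D.tn n := by
      rw [add_sub_cancel_left]
      have h1 := D.t_def (D.L (n + 1))
      have h2 := D.t_def (D.L n)
      change D.tn (n + 1) = _ at h1
      change D.tn n = _ at h2
      rw [h1, h2, ← Complex.sub_im]; congr 1; ring
    rw [this]; rfl
  rw [key, div_mul_cancel₀ _ hΔ]; ring

/-- The level curve has the prescribed longitudinal coordinate. [folklore] -/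
theorem a_levelPt (c τ : ℝ) : D.a (D.levelPt c τ) = c := by
  set n := D.idx τ with hn
  have ht := D.t_levelPt c τ
  have h1 : D.tn n ≤ D.t (D.levelPt c τ) := by rw [ht]; exact D.tn_idx_le τ
  have h2 : D.t (D.levelPt c τ) ≤ D.tn (n + 1) := by rw [ht]; exact (D.lt_tn_idx_succ τ).le
  rw [D.a_eq_alpha h1 h2, alpha]
  have := coordP_of_eq (D.isQuad n).det_ne_zero c ((τ - D.tn n) / (D.tn (n + 1) - D.tn n))
  rw [add_sub_cancel_left] at this
  convert this using 2
  rw [levelPt, ← hn]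

/-- **A point is determined by its two coordinates** `(t, a)`. [folklore] -/
theorem eq_of_t_eq_of_a_eq {Y Y' : ℂ} (ht : D.t Y = D.t Y') (ha : D.a Y = D.a Y') : Y = Y' := by
  set n := D.idx (D.t Y) with hn
  have hD := (D.isQuad n).det_ne_zero
  have h1 : D.tn n ≤ D.t Y := D.tn_idx_le _
  have h2 : D.t Y < D.tn (n + 1) := D.lt_tn_idx_succ _
  have hαY : D.a Y = D.alpha n Y := D.a_eq_alpha h1 h2.le
  have hαY' : D.a Y' = D.alpha n Y' := D.a_eq_alpha (ht ▸ h1) (ht ▸ h2).le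
  have hβ : coordQ (D.L n) (D.L n + D.w) (D.L (n + 1)) Y = coordQ (D.L n) (D.L n + D.w) (D.L (n + 1)) Y' := by
    rw [D.coordQ_eq, D.coordQ_eq, ht]
  rw [eq_coord hD Y, eq_coord hD Y']
  unfold alpha at hαY hαY'
  rw [← hαY, ← hαY', ha, hβ]

/-- The point of the level curve `{a = a Y}` at height `t Y` is `Y` itself. [folklore] -/
theorem levelPt_t_a (Y : ℂ) : D.levelPt (D.a Y) (D.t Y) = Y :=
  D.eq_of_t_eq_of_a_eq (D.t_levelPt _ _) (D.a_levelPt _ _)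

/-- **The open lower side `{a < c}` of a strip is path-connected** (go down along `w`, then along
a level curve, then up). [cite: GrimmettManolescu2014Isoradial, §4.2 (a track viewed as an arc of ℝ² has two sides)] -/
theorem isPathConnected_setOf_a_lt (c : ℝ) : IsPathConnected {Y | D.a Y < c} := by
  rw [isPathConnected_iff]
  refine ⟨⟨D.levelPt (c - 1) 0, by simp only [mem_setOf_eq, a_levelPt]; linarith⟩, ?_⟩
  intro Y₁ h₁ Y₂ h₂
  simp only [mem_setOf_eq] at h₁ h₂
  set ℓ : ℝ := min (D.a Y₁) (D.a Y₂) - 1 with hℓ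
  have hℓ1 : ℓ < D.a Y₁ := by simp only [hℓ]; linarith [min_le_left (D.a Y₁) (D.a Y₂)]
  have hℓ2 : ℓ < D.a Y₂ := by simp only [hℓ]; linarith [min_le_right (D.a Y₁) (D.a Y₂)]
  have hℓc : ℓ < c := lt_trans hℓ1 h₁
  -- down from `Y₁` to the level `ℓ`
  set Y₁' := Y₁ + ((ℓ - D.a Y₁ : ℝ) : ℂ) * D.w with hY₁'
  set Y₂' := Y₂ + ((ℓ - D.a Y₂ : ℝ) : ℂ) * D.w with hY₂'
  have seg : ∀ (Y : ℂ), D.a Y < c → ∀ s : ℝ, s ≤ 0 →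
      segment ℝ Y (Y + (s : ℂ) * D.w) ⊆ {Z | D.a Z < c} := by
    intro Y hY s hs Z hZ
    rw [segment_eq_image] at hZ
    obtain ⟨θ, ⟨hθ0, hθ1⟩, rfl⟩ := hZ
    have : (1 - θ) • Y + θ • (Y + (s : ℂ) * D.w) = Y + ((θ * s : ℝ) : ℂ) * D.w := by
      simp only [Complex.real_smul]; push_cast; ring
    simp only [mem_setOf_eq, this, D.a_add_real_mul_w]
    nlinarith
  have j1 : JoinedIn {Z | D.a Z < c} Y₁ Y₁' :=
    JoinedIn.of_segment_subset (seg Y₁ h₁ _ (by linarith))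
  have j3 : JoinedIn {Z | D.a Z < c} Y₂ Y₂' :=
    JoinedIn.of_segment_subset (seg Y₂ h₂ _ (by linarith))
  -- along the level curve
  have hY₁'eq : Y₁' = D.levelPt ℓ (D.t Y₁) := by
    apply D.eq_of_t_eq_of_a_eq
    · rw [hY₁', D.t_add_real_mul_w, D.t_levelPt]
    · rw [hY₁', D.a_add_real_mul_w, D.a_levelPt]; ring
  have hY₂'eq : Y₂' = D.levelPt ℓ (D.t Y₂) := by
    apply D.eq_of_t_eq_of_a_eq
    · rw [hY₂', D.t_add_real_mul_w, D.t_levelPt]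
    · rw [hY₂', D.a_add_real_mul_w, D.a_levelPt]; ring
  have hrange : range (D.levelPt ℓ) ⊆ {Z | D.a Z < c} := by
    rintro _ ⟨τ, rfl⟩; simp only [mem_setOf_eq, D.a_levelPt]; exact hℓc
  have j2 : JoinedIn {Z | D.a Z < c} Y₁' Y₂' := by
    have hpc := isPathConnected_range (D.continuous_levelPt ℓ)
    have := hpc.joinedIn _ ⟨D.t Y₁, hY₁'eq.symm⟩ _ ⟨D.t Y₂, hY₂'eq.symm⟩
    exact this.mono hrange
  exact (j1.trans j2).trans j3.symm

/-- **The open upper side `{c < a}` of a strip is path-connected.** [cite: GrimmettManolescu2014Isoradial, §4.2 (a track viewed as an arc of ℝ² has two sides)] -/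
theorem isPathConnected_setOf_lt_a (c : ℝ) : IsPathConnected {Y | c < D.a Y} := by
  rw [isPathConnected_iff]
  refine ⟨⟨D.levelPt (c + 1) 0, by simp only [mem_setOf_eq, a_levelPt]; linarith⟩, ?_⟩
  intro Y₁ h₁ Y₂ h₂
  simp only [mem_setOf_eq] at h₁ h₂
  set ℓ : ℝ := max (D.a Y₁) (D.a Y₂) + 1 with hℓ
  have hℓ1 : D.a Y₁ < ℓ := by simp only [hℓ]; linarith [le_max_left (D.a Y₁) (D.a Y₂)]
  have hℓ2 : D.a Y₂ < ℓ := by simp only [hℓ]; linarith [le_max_right (D.a Y₁) (D.a Y₂)]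
  have hℓc : c < ℓ := lt_trans h₁ hℓ1
  set Y₁' := Y₁ + ((ℓ - D.a Y₁ : ℝ) : ℂ) * D.w with hY₁'
  set Y₂' := Y₂ + ((ℓ - D.a Y₂ : ℝ) : ℂ) * D.w with hY₂'
  have seg : ∀ (Y : ℂ), c < D.a Y → ∀ s : ℝ, 0 ≤ s →
      segment ℝ Y (Y + (s : ℂ) * D.w) ⊆ {Z | c < D.a Z} := by
    intro Y hY s hs Z hZ
    rw [segment_eq_image] at hZ
    obtain ⟨θ, ⟨hθ0, hθ1⟩, rfl⟩ := hZ
    have : (1 - θ) • Y + θ • (Y + (s : ℂ) * D.w) = Y + ((θ * s : ℝ) : ℂ) * D.w := by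
      simp only [Complex.real_smul]; push_cast; ring
    simp only [mem_setOf_eq, this, D.a_add_real_mul_w]
    nlinarith
  have j1 : JoinedIn {Z | c < D.a Z} Y₁ Y₁' :=
    JoinedIn.of_segment_subset (seg Y₁ h₁ _ (by linarith))
  have j3 : JoinedIn {Z | c < D.a Z} Y₂ Y₂' :=
    JoinedIn.of_segment_subset (seg Y₂ h₂ _ (by linarith))
  have hY₁'eq : Y₁' = D.levelPt ℓ (D.t Y₁) := by
    apply D.eq_of_t_eq_of_a_eq
    · rw [hY₁', D.t_add_real_mul_w, D.t_levelPt]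
    · rw [hY₁', D.a_add_real_mul_w, D.a_levelPt]; ring
  have hY₂'eq : Y₂' = D.levelPt ℓ (D.t Y₂) := by
    apply D.eq_of_t_eq_of_a_eq
    · rw [hY₂', D.t_add_real_mul_w, D.t_levelPt]
    · rw [hY₂', D.a_add_real_mul_w, D.a_levelPt]; ring
  have hrange : range (D.levelPt ℓ) ⊆ {Z | c < D.a Z} := by
    rintro _ ⟨τ, rfl⟩; simp only [mem_setOf_eq, D.a_levelPt]; exact hℓc
  have j2 : JoinedIn {Z | c < D.a Z} Y₁' Y₂' := by
    have hpc := isPathConnected_range (D.continuous_levelPt ℓ)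
    have := hpc.joinedIn _ ⟨D.t Y₁, hY₁'eq.symm⟩ _ ⟨D.t Y₂, hY₂'eq.symm⟩
    exact this.mono hrange
  exact (j1.trans j2).trans j3.symm

end StripData

/-! ### Two ribbons with no rhombus in common -/

open Literature.Probability.LatticeModels IsoradialCriticality

variable {V F : Type*} {G : SimpleGraph V} {emb : RhombicEmbedding G F} {ε : ℝ}
variable [DecidableEq V] [DecidableEq F] (H : PlanarTilingHyps emb ε)

namespace Ribbon

variable (x₀ y₀ : St emb)

/-- Off the rhombi of a ribbon, the longitudinal coordinate is `< 0` or `> 1`. [folklore] -/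
theorem a_lt_or_lt_of_not_mem {Y : ℂ} (hY : ∀ k, Y ∉ emb.rhombus (edge H y₀ k)) :
    (stripData H y₀).a Y < 0 ∨ 1 < (stripData H y₀).a Y := by
  by_contra h
  push Not at h
  have := (stripData H y₀).mem_hull_idx h.1 h.2
  rw [hull_eq_rhombus] at this
  exact hY _ this

/-- A rhombus lies in at most one of the two closed sides of a strip. [folklore] -/
theorem not_subset_both (e : G.edgeSet) (hl : emb.rhombus e ⊆ {Y | (stripData H x₀).a Y ≤ 0})
    (hu : emb.rhombus e ⊆ {Y | 1 ≤ (stripData H x₀).a Y}) : False := by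
  set d := RhombicEmbedding.refDart e
  have hc : emb.z d.fst ∈ emb.rhombus e := by
    rw [← rhombus_refDart, rhombus_dart_eq H.iso d]; exact (corners_mem_convexHull_quad _ _ _ _).1
  have a0 : (stripData H x₀).a (emb.z d.fst) ≤ 0 := hl hc
  have a1 : 1 ≤ (stripData H x₀).a (emb.z d.fst) := hu hc
  linarith

/-- **Consecutive rhombi of another ribbon, both off this ribbon, are on the same side of it**
(they share a side). [folklore] -/
theorem same_side_succ (k : ℤ) (h0 : edge H y₀ k ∉ Set.range (edge H x₀))
    (h1 : edge H y₀ (k + 1) ∉ Set.range (edge H x₀)) :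
    (emb.rhombus (edge H y₀ k) ⊆ {Y | (stripData H x₀).a Y ≤ 0} ↔
      emb.rhombus (edge H y₀ (k + 1)) ⊆ {Y | (stripData H x₀).a Y ≤ 0}) := by
  set D := stripData H x₀ with hD
  have hsk : exit H y₀ k ∈ emb.sides (edge H y₀ k) := exit_mem H y₀ k
  have hsk1 : exit H y₀ k ∈ emb.sides (edge H y₀ (k + 1)) := by
    rw [edge_succ]; exact mem_sides_acrossEdge H _ hsk
  have hX0 : emb.z (exit H y₀ k).1 ∈ emb.rhombus (edge H y₀ k) :=
    (rhombus_refDart (edge H y₀ k)) ▸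
      FaultLine.segment_side_subset_rhombus H.iso hsk (left_mem_segment ℝ _ _)
  have hX1 : emb.z (exit H y₀ k).1 ∈ emb.rhombus (edge H y₀ (k + 1)) :=
    (rhombus_refDart (edge H y₀ (k + 1))) ▸
      FaultLine.segment_side_subset_rhombus H.iso hsk1 (left_mem_segment ℝ _ _)
  constructor
  · intro hk
    rcases rhombus_subset_or_subset H x₀ h1 with h | h
    · exact h
    · exfalso
      have a0 : D.a (emb.z (exit H y₀ k).1) ≤ 0 := hk hX0
      have a1 : 1 ≤ D.a (emb.z (exit H y₀ k).1) := h hX1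
      linarith
  · intro hk
    rcases rhombus_subset_or_subset H x₀ h0 with h | h
    · exact h
    · exfalso
      have a1 : 1 ≤ D.a (emb.z (exit H y₀ k).1) := h hX0
      have a0 : D.a (emb.z (exit H y₀ k).1) ≤ 0 := hk hX1
      linarith

/-- **A ribbon with no rhombus in common with another lies on one side of it.**
[cite: GrimmettManolescu2014Isoradial, §4.5 (non-intersecting tracks; points between tracks)] -/
theorem side_of_disjoint (hdisj : ∀ k, edge H y₀ k ∉ Set.range (edge H x₀)) :
    (∀ k, emb.rhombus (edge H y₀ k) ⊆ {Y | (stripData H x₀).a Y ≤ 0}) ∨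
    (∀ k, emb.rhombus (edge H y₀ k) ⊆ {Y | 1 ≤ (stripData H x₀).a Y}) := by
  set D := stripData H x₀ with hD
  have hall : ∀ k, (emb.rhombus (edge H y₀ k) ⊆ {Y | D.a Y ≤ 0} ↔
      emb.rhombus (edge H y₀ 0) ⊆ {Y | D.a Y ≤ 0}) := by
    intro k
    induction k using Int.induction_on with
    | zero => exact Iff.rfl
    | succ k ih => exact (same_side_succ H x₀ y₀ k (hdisj _) (hdisj _)).symm.trans ih
    | pred k ih =>
      have := same_side_succ H x₀ y₀ (-k - 1) (hdisj _) (by rw [sub_add_cancel]; exact hdisj _)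
      rw [sub_add_cancel] at this
      exact this.trans ih
  rcases rhombus_subset_or_subset H x₀ (hdisj 0) with h | h
  · exact Or.inl fun k => (hall k).2 h
  · right; intro k
    rcases rhombus_subset_or_subset H x₀ (hdisj k) with h' | h'
    · exact absurd h (fun h => not_subset_both H x₀ _ ((hall k).1 h') h)
    · exact h'

/-- **Nesting, upper case.** If the ribbon `y₀` lies in the upper side `{1 ≤ a}` of the ribbon
`x₀`, the open lower side `{a < 1}` of `x₀` lies in one open side of `y₀`.
[cite: GrimmettManolescu2014Isoradial, §4.5 (the region between two non-intersecting tracks)] -/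
theorem nest_of_subset_upper (h : ∀ k, emb.rhombus (edge H y₀ k) ⊆ {Y | 1 ≤ (stripData H x₀).a Y}) :
    {Y | (stripData H x₀).a Y < 1} ⊆ {Y | (stripData H y₀).a Y < 0} ∨
    {Y | (stripData H x₀).a Y < 1} ⊆ {Y | 1 < (stripData H y₀).a Y} := by
  set S := {Y | (stripData H x₀).a Y < 1} with hS
  have hpre : IsPreconnected S := ((stripData H x₀).isPathConnected_setOf_a_lt 1).isConnected.isPreconnected
  have hsub : S ⊆ {Y | (stripData H y₀).a Y < 0} ∪ {Y | 1 < (stripData H y₀).a Y} := by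
    intro Y hY
    apply a_lt_or_lt_of_not_mem H y₀
    intro k hYk
    have : 1 ≤ (stripData H x₀).a Y := h k hYk
    have hY' : (stripData H x₀).a Y < 1 := hY
    linarith
  have ho1 : IsOpen {Y | (stripData H y₀).a Y < 0} := isOpen_lt (stripData H y₀).continuous_a continuous_const
  have ho2 : IsOpen {Y | 1 < (stripData H y₀).a Y} := isOpen_lt continuous_const (stripData H y₀).continuous_a
  have hd : Disjoint {Y | (stripData H y₀).a Y < 0} {Y | 1 < (stripData H y₀).a Y} := by
    rw [Set.disjoint_left]; intro Y h1 h2; simp only [mem_setOf_eq] at h1 h2; linarith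
  exact hpre.subset_or_subset ho1 ho2 hd hsub

/-- **Nesting, lower case.** If the ribbon `y₀` lies in the lower side `{a ≤ 0}` of the ribbon
`x₀`, the open upper side `{0 < a}` of `x₀` lies in one open side of `y₀`.
[cite: GrimmettManolescu2014Isoradial, §4.5 (the region between two non-intersecting tracks)] -/
theorem nest_of_subset_lower (h : ∀ k, emb.rhombus (edge H y₀ k) ⊆ {Y | (stripData H x₀).a Y ≤ 0}) :
    {Y | 0 < (stripData H x₀).a Y} ⊆ {Y | (stripData H y₀).a Y < 0} ∨
    {Y | 0 < (stripData H x₀).a Y} ⊆ {Y | 1 < (stripData H y₀).a Y} := by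
  set S := {Y | 0 < (stripData H x₀).a Y} with hS
  have hpre : IsPreconnected S := ((stripData H x₀).isPathConnected_setOf_lt_a 0).isConnected.isPreconnected
  have hsub : S ⊆ {Y | (stripData H y₀).a Y < 0} ∪ {Y | 1 < (stripData H y₀).a Y} := by
    intro Y hY
    apply a_lt_or_lt_of_not_mem H y₀
    intro k hYk
    have : (stripData H x₀).a Y ≤ 0 := h k hYk
    have hY' : 0 < (stripData H x₀).a Y := hY
    linarith
  have ho1 : IsOpen {Y | (stripData H y₀).a Y < 0} := isOpen_lt (stripData H y₀).continuous_a continuous_const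
  have ho2 : IsOpen {Y | 1 < (stripData H y₀).a Y} := isOpen_lt continuous_const (stripData H y₀).continuous_a
  have hd : Disjoint {Y | (stripData H y₀).a Y < 0} {Y | 1 < (stripData H y₀).a Y} := by
    rw [Set.disjoint_left]; intro Y h1 h2; simp only [mem_setOf_eq] at h1 h2; linarith
  exact hpre.subset_or_subset ho1 ho2 hd hsub

end Ribbon

end Literature.Probability.Percolation

end

/-!
## Part XIII: the tracks of a square grid are ordered

Topic `Literature/Probability/Percolation`. Grimmett–Manolescu (PTRF 159 (2014) =
arXiv:1204.0505), §4.2: the tracks of each class `T_k` of a square grid are "indexed by `ℤ` in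
the order of their intersections with any transversal track", and (remark closing §4.2) "every
`x ∈ ℝ²` lies either in some track of `T_k` or in the region of `ℝ²` 'between' two consecutive
elements of `T_k`". For the tree's `IsSquareGridGM s t I` (sequences of rhombi) and the strips of
parts VI–XII this file proves the first half of that planar picture:

* `Ribbon.cross_opposite` — **a ribbon crossing another passes from one side to the other**: if
  `R'` shares exactly the rhombus `R' i` with `R` near `i`, then `R' (i - 1)` and `R' (i + 1)` lie
  in opposite closed sides of the strip of `R`;
* `Ribbon.halves_of_cross` — the two halves `{R' m : m < i}`, `{R' m : m > i}` of a ribbon meeting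
  `R` exactly once lie in opposite sides of `R`;
* `GridOrder.b`, `GridOrder.t_subset_upper`, `GridOrder.t_subset_lower` — for a square grid
  `IsSquareGridGM s t I`, orienting the strip coordinate of each `t i` suitably (`b_i = a_i` or
  `1 - a_i`), **the tracks `t j`, `j > i`, all lie in the closed side `{1 ≤ b_i}` of `t i`, and the
  tracks `t j`, `j < i`, in `{b_i ≤ 0}`** (proved with the transversal `s 0`, which crosses every
  `t i` exactly once, in index order: SGP clause (b));
* `GridOrder.lt_one_subset_neg` — **nesting** `{b_i < 1} ⊆ {b_{i+1} < 0}`;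
* `GridOrder.exists_strip_or_gap` — **every point of the plane lies in some track `t i`
  (`0 ≤ b_i ≤ 1`) or strictly between two consecutive ones (`1 < b_i`, `b_{i+1} < 0`)**, by local
  finiteness of the tiling along a segment to an interior point of `t 0`.

## References

* G. R. Grimmett, I. Manolescu, *Bond percolation on isoradial graphs*, PTRF 159 (2014),
  arXiv:1204.0505, §4.2 (square grids; tracks indexed in order), §4.5.
-/

noncomputable section

open Complex ComplexConjugate Metric Set Filter Topology

namespace Literature.Probability.LatticeModels

/-- Reparametrisation is symmetric. [cite: GrimmettManolescu2014Isoradial, §4.2 (tracks up to reparametrisation)] -/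
theorem IsReparametrization.symm {α : Type*} {r t : ℤ → α} (h : IsReparametrization r t) :
    IsReparametrization t r := by
  obtain ⟨c, h | h⟩ := h
  · exact ⟨-c, Or.inl fun n => by rw [h]; congr 1; ring⟩
  · exact ⟨c, Or.inr fun n => by rw [h]; congr 1; ring⟩

end Literature.Probability.LatticeModels

namespace Literature.Probability.Percolation

open Literature.Probability.LatticeModels IsoradialCriticality

variable {V F : Type*} {G : SimpleGraph V} {emb : RhombicEmbedding G F} {ε : ℝ}
variable [DecidableEq V] [DecidableEq F] (H : PlanarTilingHyps emb ε)

namespace Ribbon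

variable (x₀ y₀ : St emb)

/-- The points of a side of the `k`-th rhombus of a ribbon lie in that rhombus. [folklore] -/
theorem pair_subset_rhombus (k : ℤ) {s : V × F} (hs : s ∈ emb.sides (edge H y₀ k)) :
    ∀ X ∈ ({emb.z s.1, emb.c s.2} : Set ℂ), X ∈ emb.rhombus (edge H y₀ k) := by
  intro X hX
  have hseg := FaultLine.segment_side_subset_rhombus H.iso hs
  rw [rhombus_refDart] at hseg
  rcases hX with rfl | rfl
  · exact hseg (left_mem_segment ℝ _ _)
  · exact hseg (right_mem_segment ℝ _ _)

/-- The entry and exit sides of a rhombus of a ribbon are distinct. [folklore] -/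
theorem entry_ne_exit (i : ℤ) : entry H y₀ i ≠ exit H y₀ i := by
  intro h; have := congrArg (emb.oppositeSide (edge H y₀ i)) h
  rw [oppositeSide_entry] at this
  have hdisj := pair_oppositeSide_eq H.iso (edge H y₀ i) (exit_mem H y₀ i)
  rw [← this, Set.inter_self] at hdisj
  exact (Set.insert_nonempty _ _).ne_empty hdisj

/-- **A ribbon crossing another passes from one side of it to the other.** If the ribbons `y₀`
and `x₀` are distinct (as sets of rhombi) and share the rhombus `edge y₀ i = edge x₀ a`, while
`edge y₀ (i - 1)` and `edge y₀ (i + 1)` are not rhombi of `x₀`, then these two rhombi lie in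
opposite closed sides `{a ≤ 0}`, `{1 ≤ a}` of the strip of `x₀`.
[cite: GrimmettManolescu2014Isoradial, §4.2 (transversal intersections of tracks)] -/
theorem cross_opposite (hne : Set.range (edge H y₀) ≠ Set.range (edge H x₀)) {i a : ℤ}
    (ha : edge H y₀ i = edge H x₀ a) (hbef : edge H y₀ (i - 1) ∉ Set.range (edge H x₀))
    (haft : edge H y₀ (i + 1) ∉ Set.range (edge H x₀)) :
    (emb.rhombus (edge H y₀ (i - 1)) ⊆ {Y | (stripData H x₀).a Y ≤ 0} ∧
        emb.rhombus (edge H y₀ (i + 1)) ⊆ {Y | 1 ≤ (stripData H x₀).a Y}) ∨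
    (emb.rhombus (edge H y₀ (i - 1)) ⊆ {Y | 1 ≤ (stripData H x₀).a Y} ∧
        emb.rhombus (edge H y₀ (i + 1)) ⊆ {Y | (stripData H x₀).a Y ≤ 0}) := by
  set D := stripData H x₀ with hD
  have hnpar : ¬ (w H y₀ = w H x₀ ∨ w H y₀ = -w H x₀) :=
    fun hpar => hne (range_eq_of_parallel H x₀ y₀ ha hpar)
  have hlat : ∀ {s : V × F}, (s = entry H y₀ i ∨ s = exit H y₀ i) →
      s ≠ entry H x₀ a ∧ s ≠ exit H x₀ a := by
    intro s hs
    have hv := vec_of_entry_or_exit H y₀ i hs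
    constructor
    · rintro rfl; exact hnpar (par_of_eq (vec_of_entry_or_exit H x₀ a (Or.inl rfl)) hv)
    · rintro rfl; exact hnpar (par_of_eq (vec_of_entry_or_exit H x₀ a (Or.inr rfl)) hv)
  have hexit_mem : exit H y₀ i ∈ emb.sides (edge H x₀ a) := ha ▸ exit_mem H y₀ i
  have hentry_mem : entry H y₀ i ∈ emb.sides (edge H x₀ a) := ha ▸ entry_mem H y₀ i
  -- exit side ⊆ rhombus (i+1); entry side ⊆ rhombus (i-1)
  have hexit_sub : ∀ X ∈ ({emb.z (exit H y₀ i).1, emb.c (exit H y₀ i).2} : Set ℂ),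
      X ∈ emb.rhombus (edge H y₀ (i + 1)) := by
    apply pair_subset_rhombus H y₀
    rw [edge_succ]; exact mem_sides_acrossEdge H _ (exit_mem H y₀ i)
  have hentry_sub : ∀ X ∈ ({emb.z (entry H y₀ i).1, emb.c (entry H y₀ i).2} : Set ℂ),
      X ∈ emb.rhombus (edge H y₀ (i - 1)) := by
    rw [entry_eq_exit_pred]
    exact pair_subset_rhombus H y₀ (i - 1) (exit_mem H y₀ (i - 1))
  obtain ⟨he1, he2⟩ := hlat (Or.inr rfl)
  obtain ⟨hn1, hn2⟩ := hlat (Or.inl rfl)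
  have hcx := lateral_cases H x₀ a hexit_mem he1 he2
  have hcn := lateral_cases H x₀ a hentry_mem hn1 hn2
  have hdist := entry_ne_exit H y₀ i
  -- sides of rhombus (i±1)
  have hs_aft := rhombus_subset_or_subset H x₀ haft
  have hs_bef := rhombus_subset_or_subset H x₀ hbef
  -- helper: a rhombus on a closed side containing a point of `a`-value `v`
  have key_up : ∀ {e : G.edgeSet} {X : ℂ}, X ∈ emb.rhombus e → D.a X = 1 →
      (emb.rhombus e ⊆ {Y | D.a Y ≤ 0} ∨ emb.rhombus e ⊆ {Y | 1 ≤ D.a Y}) →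
      emb.rhombus e ⊆ {Y | 1 ≤ D.a Y} := by
    intro e X hX hv h
    rcases h with h | h
    · have : D.a X ≤ 0 := h hX
      linarith
    · exact h
  have key_low : ∀ {e : G.edgeSet} {X : ℂ}, X ∈ emb.rhombus e → D.a X = 0 →
      (emb.rhombus e ⊆ {Y | D.a Y ≤ 0} ∨ emb.rhombus e ⊆ {Y | 1 ≤ D.a Y}) →
      emb.rhombus e ⊆ {Y | D.a Y ≤ 0} := by
    intro e X hX hv h
    rcases h with h | h
    · exact h
    · have : 1 ≤ D.a X := h hX
      linarith
  rcases hcx with ⟨hpx, hx0, -⟩ | ⟨hpx, hx1, -⟩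
  · -- exit is the `a = 0` lateral ⇒ rhombus (i+1) low; entry must be the `a = 1` lateral
    have haft' := key_low (hexit_sub _ (by simp)) hx0 hs_aft
    rcases hcn with ⟨hpn, -, -⟩ | ⟨hpn, hn1v, -⟩
    · exact absurd (side_eq_of_pair_eq H.iso H.tiling _ hentry_mem hexit_mem (hpn.trans hpx.symm)) hdist
    · exact Or.inr ⟨key_up (hentry_sub _ (by simp)) hn1v hs_bef, haft'⟩
  · have haft' := key_up (hexit_sub _ (by simp)) hx1 hs_aft
    rcases hcn with ⟨hpn, hn0, -⟩ | ⟨hpn, -, -⟩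
    · exact Or.inl ⟨key_low (hentry_sub _ (by simp)) hn0 hs_bef, haft'⟩
    · exact absurd (side_eq_of_pair_eq H.iso H.tiling _ hentry_mem hexit_mem (hpn.trans hpx.symm)) hdist

/-- **The two halves of a ribbon meeting another exactly once lie on opposite sides of it.**
[cite: GrimmettManolescu2014Isoradial, §4.2 (transversal intersections of tracks)] -/
theorem halves_of_cross {i a : ℤ} (ha : edge H y₀ i = edge H x₀ a)
    (honly : ∀ m, m ≠ i → edge H y₀ m ∉ Set.range (edge H x₀)) :
    ((∀ m, m < i → emb.rhombus (edge H y₀ m) ⊆ {Y | (stripData H x₀).a Y ≤ 0}) ∧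
        ∀ m, i < m → emb.rhombus (edge H y₀ m) ⊆ {Y | 1 ≤ (stripData H x₀).a Y}) ∨
    ((∀ m, m < i → emb.rhombus (edge H y₀ m) ⊆ {Y | 1 ≤ (stripData H x₀).a Y}) ∧
        ∀ m, i < m → emb.rhombus (edge H y₀ m) ⊆ {Y | (stripData H x₀).a Y ≤ 0}) := by
  set D := stripData H x₀ with hD
  have hne : Set.range (edge H y₀) ≠ Set.range (edge H x₀) := by
    intro h
    have : edge H y₀ (i + 1) ∈ Set.range (edge H x₀) := h ▸ ⟨i + 1, rfl⟩
    exact honly (i + 1) (by omega) this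
  -- propagation along each half
  have hafter : ∀ m, i < m → (emb.rhombus (edge H y₀ m) ⊆ {Y | D.a Y ≤ 0} ↔
      emb.rhombus (edge H y₀ (i + 1)) ⊆ {Y | D.a Y ≤ 0}) := by
    intro m hm
    obtain ⟨k, rfl⟩ : ∃ k : ℕ, m = i + 1 + k := ⟨(m - (i + 1)).toNat, by omega⟩
    induction k with
    | zero => simp
    | succ k ih =>
      have := same_side_succ H x₀ y₀ (i + 1 + k) (honly _ (by omega)) (honly _ (by omega))
      push_cast at this ih ⊢
      rw [show i + 1 + (k + 1 : ℤ) = i + 1 + k + 1 by ring]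
      exact this.symm.trans (ih (by omega))
  have hbefore : ∀ m, m < i → (emb.rhombus (edge H y₀ m) ⊆ {Y | D.a Y ≤ 0} ↔
      emb.rhombus (edge H y₀ (i - 1)) ⊆ {Y | D.a Y ≤ 0}) := by
    intro m hm
    obtain ⟨k, rfl⟩ : ∃ k : ℕ, m = i - 1 - k := ⟨(i - 1 - m).toNat, by omega⟩
    induction k with
    | zero => simp
    | succ k ih =>
      have := same_side_succ H x₀ y₀ (i - 1 - (k + 1 : ℕ)) (honly _ (by push_cast; omega))
        (by push_cast; rw [show i - 1 - (k + 1 : ℤ) + 1 = i - 1 - k by ring]; exact honly _ (by omega))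
      push_cast at this ih ⊢
      rw [show i - 1 - (k + 1 : ℤ) + 1 = i - 1 - k by ring] at this
      exact this.trans (ih (by omega))
  have excl : ∀ m, m ≠ i → (¬ emb.rhombus (edge H y₀ m) ⊆ {Y | D.a Y ≤ 0} ↔
      emb.rhombus (edge H y₀ m) ⊆ {Y | 1 ≤ D.a Y}) := by
    intro m hm
    constructor
    · intro h; rcases rhombus_subset_or_subset H x₀ (honly m hm) with h' | h'
      · exact absurd h' h
      · exact h'
    · intro h h'; exact not_subset_both H x₀ _ h' h
  rcases cross_opposite H x₀ y₀ hne ha (honly _ (by omega)) (honly _ (by omega)) with ⟨hb, hf⟩ | ⟨hb, hf⟩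
  · left
    refine ⟨fun m hm => (hbefore m hm).2 hb, fun m hm => ?_⟩
    rw [← excl m (by omega)]
    intro h
    exact not_subset_both H x₀ _ ((hafter m hm).1 h |> fun h' => h') hf |>.elim
  · right
    refine ⟨fun m hm => ?_, fun m hm => (hafter m hm).2 hf⟩
    rw [← excl m (by omega)]
    intro h
    exact not_subset_both H x₀ _ ((hbefore m hm).1 h) hb

end Ribbon

/-! ### The tracks of a square grid, as ribbons, and their order -/

namespace GridOrder

variable {s t : ℤ → ℤ → G.edgeSet} {I : ℕ}

/-- A track is a ribbon: a presentation by a state. [cite: GrimmettManolescu2014Isoradial, §4.2] -/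
theorem exists_st {r : ℤ → G.edgeSet} (hr : emb.IsTrack r) :
    ∃ y : Ribbon.St emb, ∀ n, r n = Ribbon.edge H y n := by
  obtain ⟨σ, hσ⟩ := hr
  exact ⟨⟨(r 0, σ 0), (hσ 0).1⟩, fun n => (eq_ribbon_of_isTrack H hσ n).1⟩

/-- A state presenting the grid track `t i`. [folklore] -/
def stT (hg : emb.IsSquareGridGM s t I) (i : ℤ) : Ribbon.St emb :=
  Classical.choose (exists_st H (hg.isSimpleTrack_right i).1)

/-- The grid track `t i` is the ribbon of its chosen state. [folklore] -/
theorem t_eq (hg : emb.IsSquareGridGM s t I) (i n : ℤ) : t i n = Ribbon.edge H (stT H hg i) n :=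
  Classical.choose_spec (exists_st H (hg.isSimpleTrack_right i).1) n

/-- The longitudinal coordinate of the strip of `t i`. [folklore] -/
def aT (hg : emb.IsSquareGridGM s t I) (i : ℤ) (Y : ℂ) : ℝ := (Ribbon.stripData H (stT H hg i)).a Y

/-- The strip coordinate of a grid track is continuous. [folklore] -/
theorem continuous_aT (hg : emb.IsSquareGridGM s t I) (i : ℤ) : Continuous (aT H hg i) :=
  (Ribbon.stripData H (stT H hg i)).continuous_a

variable (hg : emb.IsSquareGridGM s t I)

/-- Distinct grid tracks share no rhombus. [cite: GrimmettManolescu2014Isoradial, §4.2 (SGP (a): tracks of `T_k` do not intersect)] -/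
theorem t_not_mem_range {i j : ℤ} (hij : i ≠ j) (k : ℤ) :
    t j k ∉ Set.range (Ribbon.edge H (stT H hg i)) := by
  rintro ⟨n, hn⟩
  exact hg.pairwise_not_trackMeets_right hij.symm ⟨k, n, by rw [t_eq H hg i n]; exact hn.symm⟩

/-- **Another grid track lies on one closed side.** [cite: GrimmettManolescu2014Isoradial, §4.2] -/
theorem side {i j : ℤ} (hij : i ≠ j) :
    (∀ k, emb.rhombus (t j k) ⊆ {Y | aT H hg i Y ≤ 0}) ∨
    (∀ k, emb.rhombus (t j k) ⊆ {Y | 1 ≤ aT H hg i Y}) := by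
  have := Ribbon.side_of_disjoint H (stT H hg i) (stT H hg j)
    (fun k => by rw [← t_eq H hg j k]; exact t_not_mem_range H hg hij k)
  simp only [← t_eq H hg j] at this
  exact this

/-- A rhombus is not on both closed sides. [folklore] -/
theorem not_both (i : ℤ) (e : G.edgeSet) (h0 : emb.rhombus e ⊆ {Y | aT H hg i Y ≤ 0})
    (h1 : emb.rhombus e ⊆ {Y | 1 ≤ aT H hg i Y}) : False :=
  Ribbon.not_subset_both H (stT H hg i) e h0 h1

/-- The transversal `s 0` crosses the family `t` in order. [cite: GrimmettManolescu2014Isoradial, §4.2 (SGP (b))] -/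
theorem crosses {emb : RhombicEmbedding G F} {s t : ℤ → ℤ → G.edgeSet} {I : ℕ}
    (hg : emb.IsSquareGridGM s t I) : CrossesInOrder (s 0) t :=
  hg.crossesInOrder_right (s 0) (hg.isSimpleTrack_left 0).1
    fun j h => hg.not_isReparametrization 0 j h.symm

/-- **Comparison of sides along the transversal.** For `i < j`, the track `t j` is on the closed
side `{a_i ≤ 0}` of `t i` iff `t (i+1)` is. [cite: GrimmettManolescu2014Isoradial, §4.2 (tracks indexed in the order of their intersections)] -/
theorem low_iff_of_lt {i j : ℤ} (hij : i < j) :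
    (∀ k, emb.rhombus (t j k) ⊆ {Y | aT H hg i Y ≤ 0}) ↔
    (∀ k, emb.rhombus (t (i + 1) k) ⊆ {Y | aT H hg i Y ≤ 0}) := by
  obtain ⟨z, hz⟩ := exists_st H (hg.isSimpleTrack_left 0).1
  obtain ⟨φ, hmono, hmeet⟩ := crosses hg
  -- the common rhombus of `s 0` and `t m` is `s 0 (φ m)`
  have hcommon : ∀ m, ∃ n, Ribbon.edge H z (φ m) = Ribbon.edge H (stT H hg m) n := by
    intro m
    have : φ m ∈ meetIndices (s 0) (t m) := by rw [hmeet]; exact rfl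
    obtain ⟨n, hn⟩ := this
    exact ⟨n, by rw [← hz, hn, t_eq H hg m n]⟩
  have honly : ∀ m k, k ≠ φ m → Ribbon.edge H z k ∉ Set.range (Ribbon.edge H (stT H hg m)) := by
    intro m k hk ⟨n, hn⟩
    have : k ∈ meetIndices (s 0) (t m) := ⟨n, by rw [hz, ← hn, t_eq H hg m n]⟩
    rw [hmeet] at this
    exact hk this
  have hφinj : Function.Injective φ := by
    rcases hmono with h | h
    · exact h.injective
    · exact h.injective
  -- halves of `s 0` with respect to `t i`
  obtain ⟨nᵢ, hnᵢ⟩ := hcommon i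
  have halves := Ribbon.halves_of_cross H (stT H hg i) z hnᵢ (fun m hm => honly i m hm)
  -- generic step: for `m ≠ i`, the side of `t m` is the side of `T_m := s 0 (φ m)`
  have hTm : ∀ m, m ≠ i → ∀ (S S' : Set ℂ),
      (S = {Y | aT H hg i Y ≤ 0} ∧ S' = {Y | 1 ≤ aT H hg i Y} ∨
        S = {Y | 1 ≤ aT H hg i Y} ∧ S' = {Y | aT H hg i Y ≤ 0}) →
      emb.rhombus (Ribbon.edge H z (φ m)) ⊆ S →
      ((∀ k, emb.rhombus (t m k) ⊆ {Y | aT H hg i Y ≤ 0}) ↔ S = {Y | aT H hg i Y ≤ 0}) := by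
    intro m hm S S' hSS' hT
    obtain ⟨n, hn⟩ := hcommon m
    have hTn : emb.rhombus (t m n) ⊆ S := by rw [t_eq H hg m n, ← hn]; exact hT
    constructor
    · intro hlow
      rcases hSS' with ⟨rfl, -⟩ | ⟨rfl, -⟩
      · rfl
      · exact (not_both H hg i _ (hlow n) hTn).elim
    · rintro rfl
      rcases side H hg hm.symm with h | h
      · exact h
      · exact (not_both H hg i _ hTn (h n)).elim
  have hi1 : i + 1 ≠ i := by omega
  have hj : j ≠ i := by omega
  -- positions of `φ (i+1)` and `φ j` relative to `φ i`: same side (both after, or both before)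
  have hpos : (φ i < φ (i + 1) ∧ φ i < φ j) ∨ (φ (i + 1) < φ i ∧ φ j < φ i) := by
    rcases hmono with h | h
    · exact Or.inl ⟨h (by omega), h hij⟩
    · exact Or.inr ⟨h (by omega), h hij⟩
  rcases halves with ⟨hbef, haft⟩ | ⟨hbef, haft⟩
  · rcases hpos with ⟨h1, h2⟩ | ⟨h1, h2⟩
    · rw [hTm (i + 1) hi1 _ _ (Or.inr ⟨rfl, rfl⟩) (haft _ h1), hTm j hj _ _ (Or.inr ⟨rfl, rfl⟩) (haft _ h2)]
    · rw [hTm (i + 1) hi1 _ _ (Or.inl ⟨rfl, rfl⟩) (hbef _ h1), hTm j hj _ _ (Or.inl ⟨rfl, rfl⟩) (hbef _ h2)]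
  · rcases hpos with ⟨h1, h2⟩ | ⟨h1, h2⟩
    · rw [hTm (i + 1) hi1 _ _ (Or.inl ⟨rfl, rfl⟩) (haft _ h1), hTm j hj _ _ (Or.inl ⟨rfl, rfl⟩) (haft _ h2)]
    · rw [hTm (i + 1) hi1 _ _ (Or.inr ⟨rfl, rfl⟩) (hbef _ h1), hTm j hj _ _ (Or.inr ⟨rfl, rfl⟩) (hbef _ h2)]

/-- For `j < i`, the track `t j` is on the closed side `{a_i ≤ 0}` of `t i` iff `t (i+1)` is not.
[cite: GrimmettManolescu2014Isoradial, §4.2 (tracks indexed in the order of their intersections)] -/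
theorem low_iff_of_gt {i j : ℤ} (hji : j < i) :
    (∀ k, emb.rhombus (t j k) ⊆ {Y | aT H hg i Y ≤ 0}) ↔
    ¬ (∀ k, emb.rhombus (t (i + 1) k) ⊆ {Y | aT H hg i Y ≤ 0}) := by
  obtain ⟨z, hz⟩ := exists_st H (hg.isSimpleTrack_left 0).1
  obtain ⟨φ, hmono, hmeet⟩ := crosses hg
  have hcommon : ∀ m, ∃ n, Ribbon.edge H z (φ m) = Ribbon.edge H (stT H hg m) n := by
    intro m
    have : φ m ∈ meetIndices (s 0) (t m) := by rw [hmeet]; exact rfl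
    obtain ⟨n, hn⟩ := this
    exact ⟨n, by rw [← hz, hn, t_eq H hg m n]⟩
  have honly : ∀ m k, k ≠ φ m → Ribbon.edge H z k ∉ Set.range (Ribbon.edge H (stT H hg m)) := by
    intro m k hk ⟨n, hn⟩
    have : k ∈ meetIndices (s 0) (t m) := ⟨n, by rw [hz, ← hn, t_eq H hg m n]⟩
    rw [hmeet] at this
    exact hk this
  obtain ⟨nᵢ, hnᵢ⟩ := hcommon i
  have halves := Ribbon.halves_of_cross H (stT H hg i) z hnᵢ (fun m hm => honly i m hm)
  -- the side of `t m` is determined by its crossing rhombus with `s 0`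
  have hlow_of : ∀ m, m ≠ i → emb.rhombus (Ribbon.edge H z (φ m)) ⊆ {Y | aT H hg i Y ≤ 0} →
      ∀ k, emb.rhombus (t m k) ⊆ {Y | aT H hg i Y ≤ 0} := by
    intro m hm hT
    obtain ⟨n, hn⟩ := hcommon m
    have hTn : emb.rhombus (t m n) ⊆ {Y | aT H hg i Y ≤ 0} := by rw [t_eq H hg m n, ← hn]; exact hT
    rcases side H hg hm.symm with h | h
    · exact h
    · exact (not_both H hg i _ hTn (h n)).elim
  have hnot_of : ∀ m, m ≠ i → emb.rhombus (Ribbon.edge H z (φ m)) ⊆ {Y | 1 ≤ aT H hg i Y} →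
      ¬ ∀ k, emb.rhombus (t m k) ⊆ {Y | aT H hg i Y ≤ 0} := by
    intro m hm hT hlow
    obtain ⟨n, hn⟩ := hcommon m
    have hTn : emb.rhombus (t m n) ⊆ {Y | 1 ≤ aT H hg i Y} := by rw [t_eq H hg m n, ← hn]; exact hT
    exact not_both H hg i _ (hlow n) hTn
  have hi1 : i + 1 ≠ i := by omega
  have hj : j ≠ i := by omega
  have hpos : (φ j < φ i ∧ φ i < φ (i + 1)) ∨ (φ (i + 1) < φ i ∧ φ i < φ j) := by
    rcases hmono with h | h
    · exact Or.inl ⟨h hji, h (by omega)⟩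
    · exact Or.inr ⟨h (by omega), h hji⟩
  rcases halves with ⟨hbef, haft⟩ | ⟨hbef, haft⟩
  · rcases hpos with ⟨h1, h2⟩ | ⟨h1, h2⟩
    · exact iff_of_true (hlow_of j hj (hbef _ h1)) (hnot_of (i + 1) hi1 (haft _ h2))
    · refine iff_of_false (hnot_of j hj (haft _ h2)) (not_not_intro (hlow_of (i + 1) hi1 (hbef _ h1)))
  · rcases hpos with ⟨h1, h2⟩ | ⟨h1, h2⟩
    · refine iff_of_false (hnot_of j hj (hbef _ h1)) (not_not_intro (hlow_of (i + 1) hi1 (haft _ h2)))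
    · exact iff_of_true (hlow_of j hj (haft _ h2)) (hnot_of (i + 1) hi1 (hbef _ h1))

/-! ### Oriented coordinates: `t (i+1)` is above `t i` -/

/-- The family is *flipped at `i`* when `t (i+1)` lies on the side `{a_i ≤ 0}`. [folklore] -/
def Flip (i : ℤ) : Prop := ∀ k, emb.rhombus (t (i + 1) k) ⊆ {Y | aT H hg i Y ≤ 0}

open Classical in
/-- **The oriented coordinate `b_i`**: `a_i` or `1 - a_i`, so that `t (i+1) ⊆ {1 ≤ b_i}`.
[cite: GrimmettManolescu2014Isoradial, §4.2 (tracks of `T_k` indexed in order)] -/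
def b (i : ℤ) (Y : ℂ) : ℝ := if Flip H hg i then 1 - aT H hg i Y else aT H hg i Y

/-- The oriented coordinate is continuous. [folklore] -/
theorem continuous_b (i : ℤ) : Continuous (b H hg i) := by
  unfold b; split_ifs
  · exact continuous_const.sub (continuous_aT H hg i)
  · exact continuous_aT H hg i

/-- The oriented coordinate is `1 - a_i` (flipped) or `a_i` (not flipped). [folklore] -/
theorem b_cases (i : ℤ) : (Flip H hg i ∧ ∀ Y, b H hg i Y = 1 - aT H hg i Y) ∨
    (¬ Flip H hg i ∧ ∀ Y, b H hg i Y = aT H hg i Y) := by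
  by_cases h : Flip H hg i
  · exact Or.inl ⟨h, fun Y => by simp [b, h]⟩
  · exact Or.inr ⟨h, fun Y => by simp [b, h]⟩

/-- The strip of `t i` in the oriented coordinate. [folklore] -/
theorem strip_iff (i : ℤ) (Y : ℂ) :
    (0 ≤ b H hg i Y ∧ b H hg i Y ≤ 1) ↔ (0 ≤ aT H hg i Y ∧ aT H hg i Y ≤ 1) := by
  rcases b_cases H hg i with ⟨-, h⟩ | ⟨-, h⟩ <;> rw [h]
  constructor <;> rintro ⟨h1, h2⟩ <;> constructor <;> linarith

/-- **A point with `0 ≤ b_i ≤ 1` lies in a rhombus of `t i`, and conversely.** [folklore] -/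
theorem strip_iff_exists (i : ℤ) (Y : ℂ) :
    (0 ≤ b H hg i Y ∧ b H hg i Y ≤ 1) ↔ ∃ k, Y ∈ emb.rhombus (t i k) := by
  rw [strip_iff]
  constructor
  · rintro ⟨h0, h1⟩
    have := (Ribbon.stripData H (stT H hg i)).mem_hull_idx h0 h1
    rw [Ribbon.hull_eq_rhombus] at this
    exact ⟨_, by rw [t_eq H hg i]; exact this⟩
  · rintro ⟨k, hk⟩
    rw [t_eq H hg i k, ← Ribbon.hull_eq_rhombus] at hk
    exact ((Ribbon.stripData H (stT H hg i)).hull_subset _ hk).2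

/-- **All later tracks are above**: for `i < j`, `t j ⊆ {1 ≤ b_i}`.
[cite: GrimmettManolescu2014Isoradial, §4.2 (tracks of `T_k` indexed in order)] -/
theorem t_subset_upper {i j : ℤ} (hij : i < j) (k : ℤ) :
    emb.rhombus (t j k) ⊆ {Y | 1 ≤ b H hg i Y} := by
  rcases b_cases H hg i with ⟨hf, h⟩ | ⟨hf, h⟩
  · have := (low_iff_of_lt H hg hij).2 hf k
    intro Y hY; simp only [mem_setOf_eq, h]; have := this hY; simp only [mem_setOf_eq] at this; linarith
  · have hup : ∀ k, emb.rhombus (t j k) ⊆ {Y | 1 ≤ aT H hg i Y} := by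
      rcases side H hg (show i ≠ j by omega) with h' | h'
      · exact absurd ((low_iff_of_lt H hg hij).1 h') hf
      · exact h'
    intro Y hY; simp only [mem_setOf_eq, h]; exact hup k hY

/-- **All earlier tracks are below**: for `j < i`, `t j ⊆ {b_i ≤ 0}`.
[cite: GrimmettManolescu2014Isoradial, §4.2 (tracks of `T_k` indexed in order)] -/
theorem t_subset_lower {i j : ℤ} (hji : j < i) (k : ℤ) :
    emb.rhombus (t j k) ⊆ {Y | b H hg i Y ≤ 0} := by
  rcases b_cases H hg i with ⟨hf, h⟩ | ⟨hf, h⟩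
  · have hnot : ¬ ∀ k, emb.rhombus (t j k) ⊆ {Y | aT H hg i Y ≤ 0} := by
      rw [low_iff_of_gt H hg hji]; exact not_not_intro hf
    have hup : ∀ k, emb.rhombus (t j k) ⊆ {Y | 1 ≤ aT H hg i Y} := by
      rcases side H hg (show i ≠ j by omega) with h' | h'
      · exact absurd h' hnot
      · exact h'
    intro Y hY; simp only [mem_setOf_eq, h]; have := hup k hY; simp only [mem_setOf_eq] at this; linarith
  · have := (low_iff_of_gt H hg hji).2 hf k
    intro Y hY; simp only [mem_setOf_eq, h]; exact this hY

/-! ### Nesting of the sides, and the covering by strips and gaps -/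

/-- `b_i` is affine of slope `±1` along `w_i`. [folklore] -/
theorem b_add_real_mul_w (i : ℤ) (Y : ℂ) (c : ℝ) :
    b H hg i (Y + (c : ℂ) * (Ribbon.stripData H (stT H hg i)).w) = b H hg i Y + c ∨
    b H hg i (Y + (c : ℂ) * (Ribbon.stripData H (stT H hg i)).w) = b H hg i Y - c := by
  rcases b_cases H hg i with ⟨-, h⟩ | ⟨-, h⟩
  · right; rw [h, h, aT, aT, StripData.a_add_real_mul_w]; ring
  · left; rw [h, h, aT, aT, StripData.a_add_real_mul_w]

/-- Points of `K` near an interior point, displaced along `w_i`. [folklore] -/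
theorem add_mem_of_interior (i : ℤ) {K : Set ℂ} {Z : ℂ} (hZ : Z ∈ interior K) :
    ∃ δ > 0, ∀ c : ℝ, |c| < δ → Z + (c : ℂ) * (Ribbon.stripData H (stT H hg i)).w ∈ K := by
  set D := Ribbon.stripData H (stT H hg i)
  obtain ⟨δ, hδ, hball⟩ := Metric.isOpen_iff.1 isOpen_interior Z hZ
  refine ⟨δ, hδ, fun c hc => interior_subset (hball ?_)⟩
  rw [mem_ball, dist_eq_norm, add_sub_cancel_left, norm_mul, D.norm_w, mul_one, Complex.norm_real,
    Real.norm_eq_abs]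
  exact hc

/-- An interior point of a set on the closed lower side has `b < 0`. [folklore] -/
theorem b_neg_of_interior (i : ℤ) {K : Set ℂ} (hK : K ⊆ {Y | b H hg i Y ≤ 0}) {Z : ℂ}
    (hZ : Z ∈ interior K) : b H hg i Z < 0 := by
  obtain ⟨δ, hδ, hmem⟩ := add_mem_of_interior H hg i hZ
  have hp : |δ / 2| < δ := by rw [abs_of_pos (by positivity)]; linarith
  have hn : |-(δ / 2)| < δ := by rw [abs_neg, abs_of_pos (by positivity)]; linarith
  have h1 : b H hg i _ ≤ 0 := hK (hmem _ hp)
  have h2 : b H hg i _ ≤ 0 := hK (hmem _ hn)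
  rcases b_cases H hg i with ⟨-, h⟩ | ⟨-, h⟩
  · rw [h, aT, StripData.a_add_real_mul_w] at h2
    rw [h]; unfold aT; linarith
  · rw [h, aT, StripData.a_add_real_mul_w] at h1
    rw [h]; unfold aT; linarith

/-- An interior point of a set on the closed upper side has `1 < b`. [folklore] -/
theorem one_lt_b_of_interior (i : ℤ) {K : Set ℂ} (hK : K ⊆ {Y | 1 ≤ b H hg i Y}) {Z : ℂ}
    (hZ : Z ∈ interior K) : 1 < b H hg i Z := by
  obtain ⟨δ, hδ, hmem⟩ := add_mem_of_interior H hg i hZ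
  have hp : |δ / 2| < δ := by rw [abs_of_pos (by positivity)]; linarith
  have hn : |-(δ / 2)| < δ := by rw [abs_neg, abs_of_pos (by positivity)]; linarith
  have h1 : 1 ≤ b H hg i _ := hK (hmem _ hp)
  have h2 : 1 ≤ b H hg i _ := hK (hmem _ hn)
  rcases b_cases H hg i with ⟨-, h⟩ | ⟨-, h⟩
  · rw [h, aT, StripData.a_add_real_mul_w] at h1
    rw [h]; unfold aT; linarith
  · rw [h, aT, StripData.a_add_real_mul_w] at h2
    rw [h]; unfold aT; linarith

omit [DecidableEq V] [DecidableEq F] in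
/-- The centre of a rhombus is an interior point. [folklore] -/
theorem dartCentre_mem_interior (hiso : emb.IsIsoradial) (e : G.edgeSet) :
    emb.dartCentre (RhombicEmbedding.refDart e) ∈ interior (emb.rhombus e) := by
  rw [← rhombus_refDart, rhombus_dart_eq hiso]
  exact centre_mem_interior_quad (dart_isQuad hiso _)

/-- **Nesting of the open lower sides**: `{b_i < 1} ⊆ {b_{i+1} < 0}` — what is not above `t i`
is strictly below `t (i+1)`. [cite: GrimmettManolescu2014Isoradial, §4.2 (tracks of `T_k` indexed in order), §4.5] -/
theorem lt_one_subset_neg (i : ℤ) : {Y | b H hg i Y < 1} ⊆ {Y | b H hg (i + 1) Y < 0} := by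
  set x₀ := stT H hg i
  set y₀ := stT H hg (i + 1)
  -- Step 1: `{b_i < 1}` lies in one open `a_{i+1}`-side
  have hstep : {Y | b H hg i Y < 1} ⊆ {Y | (Ribbon.stripData H y₀).a Y < 0} ∨
      {Y | b H hg i Y < 1} ⊆ {Y | 1 < (Ribbon.stripData H y₀).a Y} := by
    rcases b_cases H hg i with ⟨hf, h⟩ | ⟨hf, h⟩
    · -- flipped: `t (i+1) ⊆ {a_i ≤ 0}`; `{b_i < 1} = {0 < a_i}`
      have hsub : ∀ k, emb.rhombus (Ribbon.edge H y₀ k) ⊆ {Y | (Ribbon.stripData H x₀).a Y ≤ 0} := by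
        intro k; rw [← t_eq H hg (i + 1) k]; exact hf k
      have := Ribbon.nest_of_subset_lower H x₀ y₀ hsub
      have hS : {Y | b H hg i Y < 1} = {Y | 0 < (Ribbon.stripData H x₀).a Y} := by
        ext Y; simp only [mem_setOf_eq, h]; constructor <;> intro h' <;> (try unfold aT at *) <;> linarith
      rw [hS]; exact this
    · have hsub : ∀ k, emb.rhombus (Ribbon.edge H y₀ k) ⊆ {Y | 1 ≤ (Ribbon.stripData H x₀).a Y} := by
        intro k; rw [← t_eq H hg (i + 1) k]
        rcases side H hg (show i ≠ i + 1 by omega) with h' | h'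
        · exact absurd h' hf
        · exact h' k
      have := Ribbon.nest_of_subset_upper H x₀ y₀ hsub
      have hS : {Y | b H hg i Y < 1} = {Y | (Ribbon.stripData H x₀).a Y < 1} := by
        ext Y; simp only [mem_setOf_eq, h]; rfl
      rw [hS]; exact this
  -- Step 2: a witness — the centre of a rhombus of `t (i-1)` — is in `{b_i < 1}` and has `b_{i+1} < 0`
  set Z := emb.dartCentre (RhombicEmbedding.refDart (t (i - 1) 0)) with hZ
  have hZint := dartCentre_mem_interior H.iso (t (i - 1) 0)
  have hZi : b H hg i Z < 0 := b_neg_of_interior H hg i (t_subset_lower H hg (by omega) 0) hZint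
  have hZi1 : b H hg (i + 1) Z < 0 := b_neg_of_interior H hg (i + 1) (t_subset_lower H hg (by omega) 0) hZint
  have hZS : Z ∈ {Y | b H hg i Y < 1} := by simp only [mem_setOf_eq]; linarith
  rcases b_cases H hg (i + 1) with ⟨-, h⟩ | ⟨-, h⟩
  · -- `b_{i+1} = 1 - a_{i+1}`: target `{1 < a_{i+1}}`
    rcases hstep with h' | h'
    · exfalso; have := h' hZS; simp only [mem_setOf_eq] at this; rw [h] at hZi1; unfold aT at hZi1; linarith
    · intro Y hY; have := h' hY; simp only [mem_setOf_eq] at this ⊢; rw [h]; unfold aT; linarith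
  · rcases hstep with h' | h'
    · intro Y hY; have := h' hY; simp only [mem_setOf_eq] at this ⊢; rw [h]; exact this
    · exfalso; have := h' hZS; simp only [mem_setOf_eq] at this; rw [h] at hZi1; unfold aT at hZi1; linarith

/-- Monotonicity of "strictly below": `b_i Y < 0 → b_j Y < 0` for `i ≤ j`. [folklore] -/
theorem neg_mono {i j : ℤ} (hij : i ≤ j) {Y : ℂ} (h : b H hg i Y < 0) : b H hg j Y < 0 := by
  obtain ⟨k, rfl⟩ : ∃ k : ℕ, j = i + k := ⟨(j - i).toNat, by omega⟩
  induction k with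
  | zero => simpa using h
  | succ k ih =>
    have := ih (by omega)
    have h1 : b H hg (i + k) Y < 1 := by linarith
    have := lt_one_subset_neg H hg (i + k) h1
    simp only [mem_setOf_eq] at this
    push_cast; rw [← add_assoc]; exact this

/-- **Every point lies in some track of the family or strictly between two consecutive ones**
(Grimmett–Manolescu, end of §4.2). [cite: GrimmettManolescu2014Isoradial, §4.2 (closing remark)] -/
theorem exists_strip_or_gap (Y : ℂ) :
    ∃ i, (0 ≤ b H hg i Y ∧ b H hg i Y ≤ 1) ∨ (1 < b H hg i Y ∧ b H hg (i + 1) Y < 0) := by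
  -- the witness point inside `t 0 0`
  set Z := emb.dartCentre (RhombicEmbedding.refDart (t 0 0)) with hZ
  have hZint := dartCentre_mem_interior H.iso (t 0 0)
  have hZmem : Z ∈ emb.rhombus (t 0 0) := interior_subset hZint
  -- finitely many tracks meet the segment `[Y, Z]`
  set R : ℝ := ‖Z - Y‖
  have hsegball : segment ℝ Y Z ⊆ closedBall Y R := by
    rw [← convexHull_pair]
    refine convexHull_min ?_ (convex_closedBall Y R)
    rintro X (rfl | hX)
    · exact mem_closedBall_self (norm_nonneg _)
    · rw [mem_singleton_iff] at hX; rw [hX, mem_closedBall, dist_eq_norm]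
  set E := {e : G.edgeSet | (emb.rhombus e ∩ closedBall Y R).Nonempty}
  have hE : E.Finite := finite_setOf_rhombus_inter_closedBall H.iso H.tiling H.bap H.pos Y R
  set Fin := {i : ℤ | ∃ k, (emb.rhombus (t i k) ∩ segment ℝ Y Z).Nonempty}
  have hFin : Fin.Finite := by
    have hsub : Fin ⊆ ⋃ e ∈ E, {i | ∃ k, t i k = e} := by
      rintro i ⟨k, X, hX1, hX2⟩
      exact mem_biUnion (show t i k ∈ E from ⟨X, hX1, hsegball hX2⟩) ⟨k, rfl⟩
    refine (hE.biUnion fun e _ => ?_).subset hsub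
    refine Set.Subsingleton.finite ?_
    rintro i ⟨k, hk⟩ j ⟨k', hk'⟩
    by_contra hij
    exact hg.pairwise_not_trackMeets_right hij ⟨k, k', hk.trans hk'.symm⟩
  -- off `Fin`, the segment misses the strip of `t i`, so `Y` and `Z` are on the same open side
  have hsame : ∀ i, i ∉ Fin → (b H hg i Y < 0 ↔ b H hg i Z < 0) := by
    intro i hi
    have hcover : segment ℝ Y Z ⊆ {X | b H hg i X < 0} ∪ {X | 1 < b H hg i X} := by
      intro X hX
      by_contra hc
      simp only [mem_union, mem_setOf_eq, not_or, not_lt] at hc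
      obtain ⟨k, hk⟩ := (strip_iff_exists H hg i X).1 ⟨hc.1, hc.2⟩
      exact hi ⟨k, X, hk, hX⟩
    have hpre : IsPreconnected (segment ℝ Y Z) := (convex_segment Y Z).isPreconnected
    have ho1 : IsOpen {X | b H hg i X < 0} := isOpen_lt (continuous_b H hg i) continuous_const
    have ho2 : IsOpen {X | 1 < b H hg i X} := isOpen_lt continuous_const (continuous_b H hg i)
    have hd : Disjoint {X | b H hg i X < 0} {X | 1 < b H hg i X} := by
      rw [Set.disjoint_left]; intro X h1 h2; simp only [mem_setOf_eq] at h1 h2; linarith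
    rcases hpre.subset_or_subset ho1 ho2 hd hcover with h | h
    · exact iff_of_true (h (left_mem_segment ℝ Y Z)) (h (right_mem_segment ℝ Y Z))
    · have h1 : 1 < b H hg i Y := h (left_mem_segment ℝ Y Z)
      have h2 : 1 < b H hg i Z := h (right_mem_segment ℝ Y Z)
      constructor <;> intro h' <;> linarith
  have hZpos : ∀ i, 0 < i → b H hg i Z < 0 := fun i hi =>
    b_neg_of_interior H hg i (t_subset_lower H hg hi 0) hZint
  have hZneg : ∀ i, i < 0 → 1 < b H hg i Z := fun i hi =>
    one_lt_b_of_interior H hg i (t_subset_upper H hg hi 0) hZint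
  -- the set of indices strictly above `Y`
  set A := {i : ℤ | b H hg i Y < 0}
  obtain ⟨M, hM⟩ := hFin.bddAbove
  obtain ⟨m, hm⟩ := hFin.bddBelow
  have hAne : A.Nonempty := by
    refine ⟨max M 0 + 1, ?_⟩
    have hnot : max M 0 + 1 ∉ Fin := fun h => by have := hM h; omega
    exact (hsame _ hnot).2 (hZpos _ (by omega))
  have hAbdd : BddBelow A := by
    refine ⟨min m 0, fun i hi => ?_⟩
    by_contra hlt
    push Not at hlt
    have hnot : i ∉ Fin := fun h => by have := hm h; omega
    have h1 := (hsame i hnot).1 hi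
    have h2 := hZneg i (by omega)
    linarith
  set i₀ := sInf A
  have hi₀ : i₀ ∈ A := Int.csInf_mem hAne hAbdd
  have hi₀' : i₀ - 1 ∉ A := fun h => by have := csInf_le hAbdd h; omega
  simp only [A, mem_setOf_eq, not_lt] at hi₀ hi₀'
  refine ⟨i₀ - 1, ?_⟩
  rw [sub_add_cancel]
  by_cases h1 : b H hg (i₀ - 1) Y ≤ 1
  · exact Or.inl ⟨hi₀', h1⟩
  · exact Or.inr ⟨lt_of_not_ge h1, hi₀⟩

end GridOrder

end Literature.Probability.Percolation

end

/-!
## Part XIV: gaps between consecutive grid tracks, and arcs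

Topic `Literature/Probability/Percolation`. Continuing part XIII (`GridOrder`): for a square grid
`IsSquareGridGM s t I` of a rhombic tiling (`PlanarTilingHyps`), with the oriented strip
coordinates `b_i` of the tracks `t i`,

* `GridOrder.gap i = {1 < b_i} ∩ {b_{i+1} < 0}` — the open region *strictly between* `t i` and
  `t (i+1)` (Grimmett–Manolescu 2014, §4.5); gaps are pairwise disjoint and the closure of a
  gap is still disjoint from every other gap (`closure_gap_subset`, `one_le_of_le`);
* `GridOrder.exists_interior_subset_gap` — **a face that is on no track `t m` has its interior
  inside a single gap** (faces "between" two consecutive tracks, §4.5);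
* `GridOrder.across_of_gap` — **the face across a side of a gap face is a face of the same gap,
  or a face of one of the two bounding tracks** `t i`, `t (i+1)`;
* `GridOrder.arc` — **arcs**: along a grid track `t m`, the faces strictly before both of its
  crossings with `s j`, `s (j+1)` or strictly after both lie below `s j` or above `s (j+1)`
  (so the faces of `t m` between `s j` and `s (j+1)` are those between the two crossings, fewer
  than `I` of them by SGP clause (c)).

## References

* G. R. Grimmett, I. Manolescu, *Bond percolation on isoradial graphs*, PTRF 159 (2014),
  arXiv:1204.0505, §4.2 (square grids), §4.5 (domains between tracks; cells).
-/

noncomputable section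

open Complex ComplexConjugate Metric Set Filter Topology

namespace Literature.Probability.Percolation

open Literature.Probability.LatticeModels IsoradialCriticality

variable {V F : Type*} {G : SimpleGraph V} {emb : RhombicEmbedding G F} {ε : ℝ}
variable [DecidableEq V] [DecidableEq F] (H : PlanarTilingHyps emb ε)

omit [DecidableEq V] [DecidableEq F] in
/-- **A point interior to one face and belonging to another forces the faces to be equal**
(interiors of distinct faces are disjoint, and a face is the closure of its interior). [folklore] -/
theorem eq_of_mem_interior_of_mem (hiso : emb.IsIsoradial) (hrh : emb.IsRhombicTiling)
    {e e' : G.edgeSet} {X : ℂ} (hX : X ∈ interior (emb.rhombus e))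
    (hX' : X ∈ emb.rhombus e') : e = e' := by
  by_contra hne
  have hq := dart_isQuad hiso (RhombicEmbedding.refDart e')
  have hK : emb.rhombus e' = convexHull ℝ {emb.z (RhombicEmbedding.refDart e').fst,
      emb.c (emb.leftFace (RhombicEmbedding.refDart e')), emb.z (RhombicEmbedding.refDart e').snd,
      emb.c (emb.rightFace (RhombicEmbedding.refDart e'))} := by
    rw [← rhombus_refDart, rhombus_dart_eq hiso]
  rw [hK] at hX'
  obtain ⟨Y, hY1, hY2⟩ := interior_inter_nonempty hq hX' hX
  rw [← hK] at hY1
  exact Set.disjoint_left.1 (hrh.disjoint_interior hne) hY2 hY1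

omit [DecidableEq V] [DecidableEq F] in
/-- A face is convex. [folklore] -/
theorem convex_rhombus_face (hiso : emb.IsIsoradial) (e : G.edgeSet) : Convex ℝ (emb.rhombus e) := by
  rw [← rhombus_refDart, rhombus_dart_eq hiso]; exact convex_convexHull ℝ _

omit [DecidableEq V] [DecidableEq F] in
/-- A face lies in the closure of its interior. [folklore] -/
theorem rhombus_subset_closure_interior_face (hiso : emb.IsIsoradial) (e : G.edgeSet) :
    emb.rhombus e ⊆ closure (interior (emb.rhombus e)) := by
  rw [← rhombus_refDart, rhombus_dart_eq hiso]
  exact subset_closure_interior_quad (dart_isQuad hiso _)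

namespace GridOrder

variable {s t : ℤ → ℤ → G.edgeSet} {I : ℕ} (hg : emb.IsSquareGridGM s t I)

/-! ### Gaps -/

/-- The open region strictly between `t i` and `t (i+1)`. [cite: GrimmettManolescu2014Isoradial, §4.5 (points strictly between two tracks)] -/
def gap (i : ℤ) : Set ℂ := {Y | 1 < b H hg i Y ∧ b H hg (i + 1) Y < 0}

/-- Gaps are open. [folklore] -/
theorem isOpen_gap (i : ℤ) : IsOpen (gap H hg i) :=
  (isOpen_lt continuous_const (continuous_b H hg i)).inter
    (isOpen_lt (continuous_b H hg (i + 1)) continuous_const)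

/-- Upward propagation of "not below": `1 ≤ b_{k'} → 1 ≤ b_k` for `k ≤ k'`. [folklore] -/
theorem one_le_of_le {k k' : ℤ} (hkk' : k ≤ k') {X : ℂ} (h : 1 ≤ b H hg k' X) : 1 ≤ b H hg k X := by
  obtain ⟨n, rfl⟩ : ∃ n : ℕ, k' = k + n := ⟨(k' - k).toNat, by omega⟩
  induction n with
  | zero => simpa using h
  | succ n ih =>
    apply ih (by omega)
    by_contra hlt
    push Not at hlt
    have := lt_one_subset_neg H hg (k + n) hlt
    simp only [mem_setOf_eq] at this
    push_cast at h; rw [← add_assoc] at h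
    linarith

/-- The closure of a gap. [folklore] -/
theorem closure_gap_subset (i : ℤ) :
    closure (gap H hg i) ⊆ {Y | 1 ≤ b H hg i Y ∧ b H hg (i + 1) Y ≤ 0} := by
  have hc : IsClosed {Y | 1 ≤ b H hg i Y ∧ b H hg (i + 1) Y ≤ 0} :=
    (isClosed_le continuous_const (continuous_b H hg i)).inter
      (isClosed_le (continuous_b H hg (i + 1)) continuous_const)
  refine (closure_minimal ?_ hc)
  rintro Y ⟨h1, h2⟩; exact ⟨h1.le, h2.le⟩

/-- **Closures of gaps do not meet other gaps' closures**: a point in the closures of `gap i` and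
`gap i'` forces `i = i'`. [folklore] -/
theorem eq_of_mem_closure_gap {i i' : ℤ} {X : ℂ} (h : X ∈ closure (gap H hg i))
    (h' : X ∈ closure (gap H hg i')) : i = i' := by
  obtain ⟨h1, h2⟩ := closure_gap_subset H hg i h
  obtain ⟨h1', h2'⟩ := closure_gap_subset H hg i' h'
  by_contra hne
  rcases lt_or_gt_of_ne hne with hlt | hlt
  · have := one_le_of_le H hg (show i + 1 ≤ i' by omega) h1'; linarith
  · have := one_le_of_le H hg (show i' + 1 ≤ i by omega) h1; linarith

/-- Distinct gaps are disjoint. [folklore] -/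
theorem gap_disjoint {i i' : ℤ} (hne : i ≠ i') : Disjoint (gap H hg i) (gap H hg i') := by
  rw [Set.disjoint_left]
  intro X h h'
  exact hne (eq_of_mem_closure_gap H hg (subset_closure h) (subset_closure h'))

/-! ### Faces off the family lie in gaps -/

/-- An interior point of a face on no track `t m` is in no strip. [folklore] -/
theorem not_strip_of_interior {e : G.edgeSet} (he : ∀ m k, t m k ≠ e) {X : ℂ}
    (hX : X ∈ interior (emb.rhombus e)) (m : ℤ) : ¬ (0 ≤ b H hg m X ∧ b H hg m X ≤ 1) := by
  intro hb
  obtain ⟨k, hk⟩ := (strip_iff_exists H hg m X).1 hb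
  exact he m k (eq_of_mem_interior_of_mem H.iso H.tiling hX hk).symm

/-- **A face on no track of the family has its interior in a single gap.**
[cite: GrimmettManolescu2014Isoradial, §4.5 (faces between two consecutive tracks)] -/
theorem exists_interior_subset_gap {e : G.edgeSet} (he : ∀ m k, t m k ≠ e) :
    ∃ i, interior (emb.rhombus e) ⊆ gap H hg i := by
  set X₀ := emb.dartCentre (RhombicEmbedding.refDart e)
  have hX₀ : X₀ ∈ interior (emb.rhombus e) := dartCentre_mem_interior H.iso e
  obtain ⟨i₀, hi₀⟩ := exists_strip_or_gap H hg X₀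
  have hgap₀ : X₀ ∈ gap H hg i₀ := by
    rcases hi₀ with h | h
    · exact absurd h (not_strip_of_interior H hg he hX₀ i₀)
    · exact h
  refine ⟨i₀, ?_⟩
  have hpre : IsPreconnected (interior (emb.rhombus e)) :=
    ((convex_rhombus_face H.iso e).interior).isPreconnected
  set U := ⋃ i ∈ {i | i ≠ i₀}, gap H hg i
  have hU : IsOpen U := isOpen_biUnion fun i _ => isOpen_gap H hg i
  have hcover : interior (emb.rhombus e) ⊆ gap H hg i₀ ∪ U := by
    intro X hX
    obtain ⟨i, hi⟩ := exists_strip_or_gap H hg X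
    have hgap : X ∈ gap H hg i := by
      rcases hi with h | h
      · exact absurd h (not_strip_of_interior H hg he hX i)
      · exact h
    by_cases hii : i = i₀
    · left; rw [← hii]; exact hgap
    · right; exact mem_biUnion hii hgap
  have hdisj : Disjoint (gap H hg i₀) U := by
    rw [Set.disjoint_left]
    intro X hX hXU
    obtain ⟨i, hi, hXi⟩ := mem_iUnion₂.1 hXU
    exact Set.disjoint_left.1 (gap_disjoint H hg (Ne.symm hi)) hX hXi
  exact hpre.subset_left_of_subset_union (isOpen_gap H hg i₀) hU hdisj hcover ⟨X₀, hX₀, hgap₀⟩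

/-- A face whose interior is in a gap lies in the closure of the gap. [folklore] -/
theorem rhombus_subset_closure_gap {e : G.edgeSet} {i : ℤ} (he : interior (emb.rhombus e) ⊆ gap H hg i) :
    emb.rhombus e ⊆ {Y | 1 ≤ b H hg i Y ∧ b H hg (i + 1) Y ≤ 0} :=
  ((rhombus_subset_closure_interior_face H.iso e).trans (closure_mono he)).trans (closure_gap_subset H hg i)

/-- A gap face is on no track of the family. [folklore] -/
theorem not_mem_range_of_gap {e : G.edgeSet} {i : ℤ} (he : interior (emb.rhombus e) ⊆ gap H hg i)
    (m k : ℤ) : t m k ≠ e := by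
  intro hmk
  set X₀ := emb.dartCentre (RhombicEmbedding.refDart e)
  have hX₀ : X₀ ∈ interior (emb.rhombus e) := dartCentre_mem_interior H.iso e
  obtain ⟨h1, h2⟩ := he hX₀
  have hstrip : 0 ≤ b H hg m X₀ ∧ b H hg m X₀ ≤ 1 :=
    (strip_iff_exists H hg m X₀).2 ⟨k, hmk ▸ interior_subset hX₀⟩
  -- `m` versus `i`, `i+1`
  rcases lt_trichotomy m i with hm | rfl | hm
  · have := t_subset_lower H hg hm k (hmk ▸ interior_subset hX₀ : X₀ ∈ emb.rhombus (t m k))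
    simp only [mem_setOf_eq] at this
    -- `b_i X₀ ≤ 0` contradicts `1 < b_i X₀`
    linarith
  · linarith [hstrip.2]
  · rcases eq_or_lt_of_le (show i + 1 ≤ m by omega) with rfl | hm'
    · linarith [hstrip.1]
    · have := t_subset_upper H hg hm' k (hmk ▸ interior_subset hX₀ : X₀ ∈ emb.rhombus (t m k))
      simp only [mem_setOf_eq] at this
      linarith

/-- **Across a side of a gap face: the same gap, or one of the two bounding tracks.**
[cite: GrimmettManolescu2014Isoradial, §4.5 (the domain between two tracks)] -/
theorem across_of_gap {e : G.edgeSet} {i : ℤ} (he : interior (emb.rhombus e) ⊆ gap H hg i)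
    {p : V × F} (hp : p ∈ emb.sides e) :
    interior (emb.rhombus (acrossEdge H e p)) ⊆ gap H hg i ∨
      acrossEdge H e p ∈ Set.range (t i) ∨ acrossEdge H e p ∈ Set.range (t (i + 1)) := by
  set e' := acrossEdge H e p
  -- a common point of the two faces
  set X := emb.z p.1
  have hXe : X ∈ emb.rhombus e :=
    (rhombus_refDart e) ▸ FaultLine.segment_side_subset_rhombus H.iso hp (left_mem_segment ℝ _ _)
  have hXe' : X ∈ emb.rhombus e' :=
    (rhombus_refDart e') ▸ FaultLine.segment_side_subset_rhombus H.iso (mem_sides_acrossEdge H e hp)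
      (left_mem_segment ℝ _ _)
  obtain ⟨hX1, hX2⟩ := rhombus_subset_closure_gap H hg he hXe
  by_cases htrack : ∃ m k, t m k = e'
  · obtain ⟨m, k, hmk⟩ := htrack
    right
    rcases lt_trichotomy m i with hm | rfl | hm
    · have := t_subset_lower H hg hm k (hmk ▸ hXe' : X ∈ emb.rhombus (t m k))
      simp only [mem_setOf_eq] at this; linarith
    · exact Or.inl ⟨k, hmk⟩
    · rcases eq_or_lt_of_le (show i + 1 ≤ m by omega) with rfl | hm'
      · exact Or.inr ⟨k, hmk⟩
      · have := t_subset_upper H hg hm' k (hmk ▸ hXe' : X ∈ emb.rhombus (t m k))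
        simp only [mem_setOf_eq] at this; linarith
  · push Not at htrack
    obtain ⟨i', hi'⟩ := exists_interior_subset_gap H hg (fun m k => htrack m k)
    obtain ⟨hX1', hX2'⟩ := rhombus_subset_closure_gap H hg hi' hXe'
    left
    rcases lt_trichotomy i' i with hlt | rfl | hlt
    · have := one_le_of_le H hg (show i' + 1 ≤ i by omega) hX1; linarith
    · exact hi'
    · have := one_le_of_le H hg (show i + 1 ≤ i' by omega) hX1'; linarith

/-! ### Halves in the oriented coordinate; arcs of a grid track between consecutive transversals -/

/-- A rhombus is not on both closed `b`-sides. [folklore] -/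
theorem not_both_b (j : ℤ) (e : G.edgeSet) (h0 : emb.rhombus e ⊆ {Y | b H hg j Y ≤ 0})
    (h1 : emb.rhombus e ⊆ {Y | 1 ≤ b H hg j Y}) : False := by
  set d := RhombicEmbedding.refDart e
  have hc : emb.z d.fst ∈ emb.rhombus e := by
    rw [← rhombus_refDart, rhombus_dart_eq H.iso d]; exact (corners_mem_convexHull_quad _ _ _ _).1
  have a0 : b H hg j (emb.z d.fst) ≤ 0 := h0 hc
  have a1 : 1 ≤ b H hg j (emb.z d.fst) := h1 hc
  linarith

/-- `Ribbon.halves_of_cross` in the oriented coordinate of the grid track `t j`. [cite: GrimmettManolescu2014Isoradial, §4.2 (transversal intersections of tracks)] -/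
theorem halves_b (j : ℤ) (y : Ribbon.St emb) {i n : ℤ}
    (ha : Ribbon.edge H y i = Ribbon.edge H (stT H hg j) n)
    (honly : ∀ m, m ≠ i → Ribbon.edge H y m ∉ Set.range (Ribbon.edge H (stT H hg j))) :
    ((∀ m, m < i → emb.rhombus (Ribbon.edge H y m) ⊆ {Y | b H hg j Y ≤ 0}) ∧
        ∀ m, i < m → emb.rhombus (Ribbon.edge H y m) ⊆ {Y | 1 ≤ b H hg j Y}) ∨
    ((∀ m, m < i → emb.rhombus (Ribbon.edge H y m) ⊆ {Y | 1 ≤ b H hg j Y}) ∧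
        ∀ m, i < m → emb.rhombus (Ribbon.edge H y m) ⊆ {Y | b H hg j Y ≤ 0}) := by
  have h := Ribbon.halves_of_cross H (stT H hg j) y ha honly
  have low_eq : ∀ (S : Set ℂ), (S ⊆ {Y | (Ribbon.stripData H (stT H hg j)).a Y ≤ 0}) =
      (S ⊆ {Y | aT H hg j Y ≤ 0}) := fun S => rfl
  have up_eq : ∀ (S : Set ℂ), (S ⊆ {Y | 1 ≤ (Ribbon.stripData H (stT H hg j)).a Y}) =
      (S ⊆ {Y | 1 ≤ aT H hg j Y}) := fun S => rfl
  simp only [low_eq, up_eq] at h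
  rcases b_cases H hg j with ⟨-, hb⟩ | ⟨-, hb⟩
  · -- flipped: `b = 1 - a`, the two sides swap
    have e1 : ∀ S : Set ℂ, S ⊆ {Y | aT H hg j Y ≤ 0} ↔ S ⊆ {Y | 1 ≤ b H hg j Y} := by
      intro S; simp only [hb]; constructor <;> intro h' Y hY <;> have := h' hY <;>
        simp only [mem_setOf_eq] at this ⊢ <;> linarith
    have e2 : ∀ S : Set ℂ, S ⊆ {Y | 1 ≤ aT H hg j Y} ↔ S ⊆ {Y | b H hg j Y ≤ 0} := by
      intro S; simp only [hb]; constructor <;> intro h' Y hY <;> have := h' hY <;>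
        simp only [mem_setOf_eq] at this ⊢ <;> linarith
    rcases h with ⟨hb1, hb2⟩ | ⟨hb1, hb2⟩
    · exact Or.inr ⟨fun m hm => (e1 _).1 (hb1 m hm), fun m hm => (e2 _).1 (hb2 m hm)⟩
    · exact Or.inl ⟨fun m hm => (e2 _).1 (hb1 m hm), fun m hm => (e1 _).1 (hb2 m hm)⟩
  · have e1 : ∀ S : Set ℂ, S ⊆ {Y | aT H hg j Y ≤ 0} ↔ S ⊆ {Y | b H hg j Y ≤ 0} := by
      intro S; simp only [hb]
    have e2 : ∀ S : Set ℂ, S ⊆ {Y | 1 ≤ aT H hg j Y} ↔ S ⊆ {Y | 1 ≤ b H hg j Y} := by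
      intro S; simp only [hb]
    rcases h with ⟨hb1, hb2⟩ | ⟨hb1, hb2⟩
    · exact Or.inl ⟨fun m hm => (e1 _).1 (hb1 m hm), fun m hm => (e2 _).1 (hb2 m hm)⟩
    · exact Or.inr ⟨fun m hm => (e2 _).1 (hb1 m hm), fun m hm => (e1 _).1 (hb2 m hm)⟩

/-- **The crossings of a grid track `t m` with `s j` and `s (j+1)`, and its arc between them.**
There are indices `κ ≠ κ'` with `t m κ ∈ s j`, `t m κ' ∈ s (j+1)`, at most `I` apart (SGP
clause (c)); the faces of `t m` strictly before both or strictly after both lie below `s j` or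
above `s (j+1)` (here `b'` is the oriented coordinate of the family `s`, i.e. `b` for `hg.symm`).
[cite: GrimmettManolescu2014Isoradial, §4.2 (SGP (b), (c)), §4.5 (cells)] -/
theorem arc (m j : ℤ) : ∃ κ κ' : ℤ, t m κ ∈ Set.range (s j) ∧ t m κ' ∈ Set.range (s (j + 1)) ∧
    (∀ k, t m k ∈ Set.range (s j) → k = κ) ∧ (∀ k, t m k ∈ Set.range (s (j + 1)) → k = κ') ∧
    κ ≠ κ' ∧ max κ κ' - min κ κ' ≤ I ∧
    (∀ k, min κ κ' < k → k < max κ κ' → ∀ j', t m k ∉ Set.range (s j')) ∧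
    ∀ k, (k < min κ κ' ∨ max κ κ' < k) →
      emb.rhombus (t m k) ⊆ {Y | b H hg.symm j Y ≤ 0} ∨
      emb.rhombus (t m k) ⊆ {Y | 1 ≤ b H hg.symm (j + 1) Y} := by
  obtain ⟨ψ, hmono, hmeet⟩ : CrossesInOrder (t m) s :=
    hg.crossesInOrder_left (t m) (hg.isSimpleTrack_right m).1 fun i => hg.not_isReparametrization i m
  have hψinj : Function.Injective ψ := by
    rcases hmono with h | h
    · exact h.injective
    · exact h.injective
  have hmem : ∀ j', t m (ψ j') ∈ Set.range (s j') := by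
    intro j'
    have : ψ j' ∈ meetIndices (t m) (s j') := by rw [hmeet]; rfl
    obtain ⟨n, hn⟩ := this
    exact ⟨n, hn.symm⟩
  have honly' : ∀ j' k, t m k ∈ Set.range (s j') → k = ψ j' := by
    rintro j' k ⟨n, hn⟩
    have : k ∈ meetIndices (t m) (s j') := ⟨n, hn.symm⟩
    rw [hmeet] at this; exact this
  set κ := ψ j
  set κ' := ψ (j + 1)
  have hne : κ ≠ κ' := fun h => by have := hψinj h; omega
  -- clause (c): the open arc has fewer than `I` faces
  have hgapI : max κ κ' - min κ κ' ≤ I := by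
    have hlt := hg.encard_trackBetween_right_lt m j
    have hset : trackBetween (t m) (s j) (s (j + 1)) = ↑(Finset.Ioo (min κ κ') (max κ κ')) := by
      ext n
      simp only [trackBetween, hmeet, mem_singleton_iff, exists_eq_left, mem_setOf_eq, Finset.coe_Ioo,
        Set.mem_Ioo]
      constructor
      · rintro (⟨h1, h2⟩ | ⟨h1, h2⟩) <;> constructor <;> omega
      · rintro ⟨h1, h2⟩
        rcases lt_or_gt_of_ne hne with h | h
        · left; constructor <;> omega
        · right; constructor <;> omega
    rw [hset, Set.encard_coe_eq_coe_finsetCard, Int.card_Ioo] at hlt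
    have : ((max κ κ' - min κ κ' - 1).toNat : ℕ∞) < I := hlt
    have h2 : (max κ κ' - min κ κ' - 1).toNat < I := by exact_mod_cast this
    have h3 : 0 ≤ max κ κ' - min κ κ' - 1 := by
      rcases lt_or_gt_of_ne hne with h | h
      · rw [max_eq_right h.le, min_eq_left h.le]; omega
      · rw [max_eq_left h.le, min_eq_right h.le]; omega
    omega
  -- the open arc contains no crossing with any `s j'`
  have harc : ∀ k, min κ κ' < k → k < max κ κ' → ∀ j', t m k ∉ Set.range (s j') := by
    intro k hk1 hk2 j' hk
    have hkj := honly' j' k hk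
    -- `ψ j'` strictly between `ψ j` and `ψ (j+1)`: impossible for a strictly monotone/antitone `ψ`
    rcases hmono with h | h
    · have h1 : κ < κ' := h (lt_add_one j)
      have hk1' : ψ j < ψ j' := by rw [← hkj]; rw [min_eq_left h1.le] at hk1; exact hk1
      have hk2' : ψ j' < ψ (j + 1) := by rw [← hkj]; rw [max_eq_right h1.le] at hk2; exact hk2
      have hj1 : j < j' := h.lt_iff_lt.1 hk1'
      have hj2 : j' < j + 1 := h.lt_iff_lt.1 hk2'
      omega
    · have h1 : κ' < κ := h (lt_add_one j)
      have hk1' : ψ (j + 1) < ψ j' := by rw [← hkj]; rw [min_eq_right h1.le] at hk1; exact hk1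
      have hk2' : ψ j' < ψ j := by rw [← hkj]; rw [max_eq_left h1.le] at hk2; exact hk2
      have hj1 : j' < j + 1 := h.lt_iff_gt.1 hk1'
      have hj2 : j < j' := h.lt_iff_gt.1 hk2'
      omega
  refine ⟨κ, κ', hmem j, hmem (j + 1), honly' j, honly' (j + 1), hne, hgapI, harc, ?_⟩
  -- sides, via the halves of `t m` with respect to `s j` and to `s (j+1)`
  set y := stT H hg m
  have hy : ∀ k, t m k = Ribbon.edge H y k := t_eq H hg m
  -- presentations of `s j`, `s (j+1)` are `stT H hg.symm _`
  have hx : ∀ j' n, s j' n = Ribbon.edge H (stT H hg.symm j') n := fun j' n => t_eq H hg.symm j' n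
  have cross_data : ∀ j', ∃ n, Ribbon.edge H y (ψ j') = Ribbon.edge H (stT H hg.symm j') n := by
    intro j'
    obtain ⟨n, hn⟩ := hmem j'
    exact ⟨n, by rw [← hy, ← hn, hx]⟩
  have honly : ∀ j' k, k ≠ ψ j' → Ribbon.edge H y k ∉ Set.range (Ribbon.edge H (stT H hg.symm j')) := by
    intro j' k hk ⟨n, hn⟩
    exact hk (honly' j' k ⟨n, by rw [hy, ← hn, hx]⟩)
  obtain ⟨n₀, hn₀⟩ := cross_data j
  obtain ⟨n₁, hn₁⟩ := cross_data (j + 1)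
  have Hj := halves_b H hg.symm j y hn₀ (honly j)
  have Hj1 := halves_b H hg.symm (j + 1) y hn₁ (honly (j + 1))
  -- positions of the two crossing faces relative to the other transversal
  have hκ'_up : emb.rhombus (Ribbon.edge H y κ') ⊆ {Y | 1 ≤ b H hg.symm j Y} := by
    obtain ⟨n, hn⟩ := hmem (j + 1)
    rw [← hy, ← hn]; exact t_subset_upper H hg.symm (lt_add_one j) n
  have hκ_low : emb.rhombus (Ribbon.edge H y κ) ⊆ {Y | b H hg.symm (j + 1) Y ≤ 0} := by
    obtain ⟨n, hn⟩ := hmem j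
    rw [← hy, ← hn]; exact t_subset_lower H hg.symm (lt_add_one j) n
  intro k hk
  simp only [hy]
  rcases lt_or_gt_of_ne hne with hlt | hlt
  · rw [min_eq_left hlt.le, max_eq_right hlt.le] at hk
    rcases hk with hk | hk
    · -- before both: below `s j`
      left
      rcases Hj with ⟨hbef, -⟩ | ⟨-, haft⟩
      · exact hbef k hk
      · exact (not_both_b H hg.symm j _ (haft κ' hlt) hκ'_up).elim
    · right
      rcases Hj1 with ⟨hbef, haft⟩ | ⟨hbef, -⟩
      · exact haft k hk
      · exact (not_both_b H hg.symm (j + 1) _ hκ_low (hbef κ hlt)).elim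
  · rw [min_eq_right hlt.le, max_eq_left hlt.le] at hk
    rcases hk with hk | hk
    · -- before `κ'`: w.r.t. `s (j+1)`, the half not containing `κ` (which is after `κ'`)
      right
      rcases Hj1 with ⟨-, haft⟩ | ⟨hbef, -⟩
      · exact (not_both_b H hg.symm (j + 1) _ hκ_low (haft κ hlt)).elim
      · exact hbef k hk
    · left
      rcases Hj with ⟨hbef, -⟩ | ⟨-, haft⟩
      · exact (not_both_b H hg.symm j _ (hbef κ' hlt) hκ'_up).elim
      · exact haft k hk

end GridOrder

end Literature.Probability.Percolation

end
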